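import Summits.AtomisticToContinuum.FouriersLaw.Theses.BondHeatUncertainty
import Summits.AtomisticToContinuum.FouriersLaw.Theorems.ExtensiveSnapshotIrreversibility.Negative.DegenerateInstances
import Summits.AtomisticToContinuum.FouriersLaw.Theorems.ExtensiveSnapshotIrreversibility.Negative.LoadBearingHypotheses
import Literature.MathematicalPhysics.KineticTheory.InfiniteChainObservables
import Literature.Probability.Divergences.FDivVariational

/-!
# Disproof of `ExtensiveSnapshotIrreversibility` — findings (cdisprove, cycles 1–3)

Crux (K) of route `BondHeatUncertainty` (item `stmt-AtomisticToContinuum-9121`):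
under weak-NESS uniqueness, along every steady-state family `μ` of `pinnedChain ω₂ lam β γ`
(all parameters `> 0`) and every `T > 0` there is `C` with, for every `N`, eventually as
`δ → 0, δ ≠ 0`: `KL(μ_{N,T+δ/2,T-δ/2} ‖ Θ_* μ_{N,T+δ/2,T-δ/2}) ≤ C · N · δ²`, `Θ(q,p) = (q,-p)`.

## Verdict so far: NO KILL.  Why it resists (read this first)

* **Uniqueness guard.** The crux has the shape `∀ params > 0, UniqAt params → ∀ μ, IsFamily μ → …`.
  Every unconditional proof of `¬ crux` (or of `¬` any variant keeping the guard) must exhibit a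
  parameter point where weak-NESS uniqueness `UniqAt` HOLDS — that is route item `NessUnique`
  (`stmt-AtomisticToContinuum-0741`, open, "L").  So all load-bearing results below are either
  conditional on `NessUnique` or drop the guard as well (harmless if uniqueness is true).
* **Physics says the bound is generous by a factor `N`.**  `K_N := limsup δ⁻² KL = 2‖h_N^odd‖²`,
  `h^odd = ½ ∫₀^∞ (P_s^* − P_s) s ds`, `s = (γ/2T²)(p_0² − p_{N-1}²)` (first-order perturbation of
  the Fokker–Planck equation in the bath temperatures; `P_s^* = Θ P_s Θ`).  Equivalently
  `K_N = A_N − B_N`, `A_N = ‖∫₀^∞ P_t s dt‖²_{L²(μ_T)}`, `B_N = ∫₀^∞ t ⟨s, P_t s⟩ dt` (and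
  `2‖h^even‖² = A_N + B_N`).  Diffusive phenomenology: `h^odd ≈ -(γτ/(T² D c_v N)) Σ_x j_x +`
  boundary terms, so `K_N = O(1)` (bulk part `O(1/N)`); the crux allows `C·N`.
* **Ballistic corner is extensive, not super-extensive (NUMERICS, this seat).**  At `lam = β = 0`
  (excluded by the crux) the NESS is Gaussian, `Σ_δ = Σ₀ + δΣ₁` exactly, and
  `K_N = tr(M_o²) = (2/T²) tr(Φ Z Zᵀ)`, `M = Σ₀⁻¹Σ₁`, `Z = ∂_δ⟨q pᵀ⟩` (even part
  `2‖h^even‖² = tr(M_e²)`).  Exact linear algebra (pure-python Lyapunov solve, folder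
  `purepy/harm_small.py`, reproduces the planner's `K_2 = 2/9, K_3 = 0.33884, K_4 = 0.46944,
  K_6 = 0.78087`), `T = 1`, `N ≤ 28`:  `K_N = κ_odd·N + O(1)` with the increment `K_{N+1} − K_N`
  converged to  `κ_odd = 1/6` exactly at `(ω₂,γ) = (1,1)` (`K_N = N/6 − 2/9 + exp. small`,
  `N ≥ 10`), `0.2065 (0.25,1)`, `0.2280 (0.05,1)`, `0.1057 (4,1)`, `0.103 (1,0.2)` (still
  drifting +0.5%/site at N = 20: weak coupling converges slowly), `0.01463 (1,5)`, `0.000952 (1,20)`;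
  conductance `G_N → 1/8, 0.1759, 0.2136, 0.0670, 0.0791, 0.0374, 0.00954` respectively; the EVEN
  part `tr(M_e²)` stays BOUNDED (`≈ 0.65` at (1,1): flat bulk temperature profile, RLL 1967).
  `T`-scaling is exact: `K_N(T) = K_N(1)/T²` (covariance linear in the bath temperatures ⇒ `KL`
  depends on `δ/T` only).  So the ballistic corner SATURATES the crux's `C·N` (with
  `C ≈ 0.25/T²` over the scanned parameters) and never exceeds it; kit job j007816 (same
  computation to `N = 512`, queued on a saturated farm) will be attached to the item as evidence
  when it runs.  Consequence for the anharmonic chain: in its nearly-harmonic window `N ≲ ℓ(T)`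
  it rides the harmonic line `≈ κ_odd N/T²`, then crosses over to the kinetic value
  `K_N ~ ℓ²/N` — `sup_N K_N/N` finite for every fixed parameter point, as the crux claims.
* **Cauchy–Schwarz floor.**  For odd `f`, `d/dδ ⟨f⟩_δ = ⟨f, h^odd⟩`, so `K_N ≥ 2 D_N² / ‖Σ_b j_b‖²`
  `≈ 2 N G_N²/⟨j²⟩`: ballistic transport forces `K_N ≳ N` (consistent, harmonic), diffusive
  transport forces nothing.  No mechanism on the ledger or in print produces `K_N ≫ N`.
* **Fixed-`N` finiteness** (`KL < ∞` needs `μ_δ ≪ Θ_*μ_δ` and `log(ρ_δ/ρ_δ∘Θ) ∈ L¹(μ_δ)`):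
  smooth positive NESS density is in print (hypoellipticity + control); integrability of the
  log-ratio is not, but a DISproof would need to prove NON-integrability — no handle.

## Cycle 2 (gen 2) — what is new (read after the verdict above)

* **The `N`-uniform content is an `L²` bound with `N²` of room relative to the sibling route.**
  By the fixed-`N` McLennan/KDN bookkeeping (route `OddSectorIrreversibility`, items
  `ResponseDensity` 9144, `ReversalKLSecondOrder` 9145, `OddDensityIsCorrector` 9146):
  `K_N = lim δ⁻² KL = ½‖h − h∘Θ‖²_{L²(μ_T)}` and `h − h∘Θ = (u − u∘Θ)/((N−1)T²)` with
  `u = ∫₀^∞ P_t J_tot dt` the equilibrium Kubo corrector of the total current (Green–Kubo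
  normalisation `⟨J_tot, u⟩ = (N−1) T² D_N`).  Hence
  `(K) ⇔ ‖P_odd u_N‖²_{L²(μ_T)} ≤ (C/2) · N (N−1)² T⁴` (`K_N = 2‖P_odd u_N‖²/((N−1)²T⁴)`,
  `P_odd u = ½(u − u∘Θ)`), i.e. `‖P_odd u_N‖ = O(N^{3/2})`, whereas the
  sibling crux `OddResponseBound` (9140) asks `‖P_odd u_N‖ = O(N^{1/2})` (`K_N = O(1/N)`).
  Equivalently (my derivation, same bookkeeping from the other end): `K_N = ½‖g − g∘Θ‖²`,
  `g = (−L_T)⁻¹ s`, `s = (γ/2T²)(p_0² − p_{N−1}²)` the boundary entropy source; `A_N = ‖g‖²`,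
  `B_N = ⟨g, g∘Θ⟩ = ∫₀^∞ t ⟨s, P_t s⟩ dt`, `K_N = A_N − B_N`, `2‖h^even‖² = A_N + B_N`.
  At the harmonic corner `B_N ≈ −N/12` (future and past boundary flows anti-correlated: ballistic
  transit), diffusively `B_N ≈ +A_N` (`g` nearly even).  CHEAPEST SUFFICIENT CONDITION for (K),
  by the triangle inequality: `∫₀^∞ ‖P_t J_tot‖_{L²(μ_T)} dt ≤ C' N^{3/2}` — "the equilibrium
  total current is forgotten in `L²` within a time `O(N)`" (`‖J_tot‖ ≍ √N`); the diffusive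
  heuristic `‖P_odd P_t J‖ ≍ t^{-3/4}` on `(1, N²)` gives `√N`, two powers of `N` to spare; the
  harmonic corner saturates `N^{3/2}` exactly (`K_N = N/6`).  A COUNTEREXAMPLE would need the odd
  part of the Kubo corrector to be anomalously large, `‖P_odd u_N‖² ≫ N³`: slower-than-ballistic
  loss of the total-current direction with the odd part surviving time-averaging — no mechanism
  (breathers are standing waves: their current averages out inside `u`).  Formal reductions
  (§7, sorry-free, stated over LOCAL verbatim copies of the sibling items so that renames there do
  not break this file — `ReversalKLSecondOrder` was retired by the sibling planner on 2026-08-16):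
  `crux_of_responseDensity : ResponseDensity' → ReversalKLSecondOrder' → SnapshotKLFinite →
  OddResponseLinear → (K)` and `crux_of_correctorBound : … → OddDensityIsCorrector' →
  CorrectorOddCubicBound → (K)` with `CorrectorOddCubicBound : ∫(u − u∘Θ)² dμ_T ≤ C·N³` — ONE
  FACTOR `N` BELOW the sibling's new engine `ConeScaleCorrector` (E1: `∫u² dμ_T ≤ C·N²`, which the
  harmonic member violates at `≍ N³` while still satisfying ours).
* **Typing remark on the sibling item 9145** (`ReversalKLSecondOrder`): it is stated through
  `(klDiv …).toReal / δ²`, so `KL = ⊤ ↦ 0` is junk-TOLERATED — it does not carry fixed-`N`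
  finiteness; §7 isolates that as `SnapshotKLFinite` (the genuinely unprinted piece: two-sided
  NESS density control / log-ratio integrability, cf. Delarue–Menozzi-type two-sided density
  bounds for Hörmander cascades; upper Gibbs-type tails are in Rey-Bellet–Thomas 2002).
* **Obstruction to measure-level proofs** (§6, landed candidate `Negative/SnapshotFunctional`):
  a `|δ|`-TV-Lipschitz family at the flip-invariant Gibbs state can have `KL(ν_δ‖Θν_δ) = ∞` for
  all `δ ≠ 0` (atom of mass `|δ|∧1` at a flipped point).  Weak/TV/bounded-observable linear
  response (Hairer–Majda style) can never give (K) by itself.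
* **Floor** (§6): `(∫ g dμ)² ≤ KL(μ‖Θ_*μ)` and `2λ∫g − λ²∫g² ≤ KL` for bounded odd `g`
  (Donsker–Varadhan with the odd test function transported by the flip) — the `t → 0` end of
  (★); instantiated on bounded odd functions of the currents it gives `K_N ≥ (response)²/∫g²`,
  which is `≍ N` at a ballistic point and `≍ 1/N` diffusively: the crux's exponent `1` is the
  smallest compatible with the (excluded) ballistic corner.
* **Tilted criterion** (§9, landed candidate `Negative/TiltedCriterion`): for `μ_δ = μ_T.tilted φ_δ`,
  `KL(μ_δ‖Θμ_δ) < ∞ ↔ φ_δ − φ_δ∘Θ ∈ L¹(μ_δ)` (exact), `KL = ∫(φ_δ − φ_δ∘Θ)dμ_δ ≤ ∫(φ_δ − φ_δ∘Θ)² dμ_δ`;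
  hence `(K) ⇐ ∫(φ_δ − φ_δ∘Θ)² dμ_δ ≤ C·N·δ²` (`crux_of_oddLogDensityBound`, sorry-free) — the
  most economical sufficient condition found: no `δ`-expansion, no limit, no lower density bound.
  HEURISTIC WHY EVEN THE BALLISTIC END OBEYS IT: the odd log-density `½(φ_δ − φ_δ∘Θ)(z)` is the
  log-odds of `z` against its reversal; a packet of energy `E` moving right typically came from
  the left bath (weight `e^{−E/T_L}`), its reversal from the right bath (`e^{−E/T_R}`), so
  `φ_δ − φ_δ∘Θ ≈ (δ/T²)·(H_→ − H_←)(z)` ("directional energy content"), whose second moment is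
  `≲ (δ²/T⁴)·Var(H) ≍ δ² N c_v/T²` — EXTENSIVE because energy fluctuations are; the harmonic value
  `K_N = N/(6T²)` is this with an `O(1)` prefactor, and diffusively the directional content is only
  defined over a mean free path, giving far less.  A counterexample would need directional
  information in the NESS snapshot growing faster than the energy variance — implausible for a
  passive chain.
* **Structural reductions** (§5, landed candidate `Negative/FamilyIndependence`, p73896): under
  the guard the conclusion is family-independent; it suffices to prove it along ONE steady-state
  family (`crux_iff_exists_family`); `C ≥ 0` WLOG; per-bond `C(N−1)` ⇔ per-site `CN`.
* **Benchmarks on record** (no new kit output: farm saturated, gen-1 job j007816 still queued):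
  harmonic corner `K_N = N/6 − 2/9 + o(1)` at `ω₂=γ=T=1` (gen-1, exact, `N ≤ 28`; rreview-13-9-0
  `N ≤ 12` identical); sibling planner's exact Gaussian benchmark for the DIFFUSIVE
  Bonetto–Lebowitz–Lukkarinen self-consistent chain: `N·∫(h−hΘ)² = 0.87 ↘ 0.79`, `N = 3…12`,
  i.e. `K_N ≈ 0.4/N` — the two solvable corners bracket the crux (`O(1/N)` diffusive, `N/6`
  ballistic, allowance `C·N`).

## Cycle 3 (gen 3) — what is new (2026-08-16; line `clausius-budget-sound-window` PICKED, lead at cycle 0)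

* **Targets pre-screen of the seven registered stubs** (§10): S0 landed (p77081); S2b, S3a closed by the drefute
  seat's candidate proofs; S1, S2a, S3b, S4 SURVIVE every cheap attack — none is false as filed.  Two precise
  additions for the lead: (i) `normSq_le_of_dissipation` is the EXACT abstract shape of the lever S3b (orbit
  differentiable in `L²(μ_T)` + the contact form bounds along the orbit ⇒ `‖k_t‖² ≤ γt/(4T²)`; constant certified
  by `clausius_rate_le`), so S3b's whole debt is "the orbit lies in the form domain"; (ii) `(K) ⟹ S4` needs the
  LOWER half of the KL expansion (`lateShape_of_lower_expansion`, `le_of_eventually_sq_sandwich`), which no stub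
  states — S1 is the upper half; the tilted floor of §9 is the tool.  `uniqAt_of_not_crux` makes the formal
  shield explicit (`¬(K)` ⇒ an instance of `NessUnique`).
* **Why no N-uniform attack can start from the stubs**: S1–S3 are fixed-`N` or bulk-independent (the budget's
  constant `γ/(4T²)` does not see `ω₂, lam, β, N`), and S4 is (K) itself up to (ii).  The only super-extensive
  scenario left is the one recorded in cycle 2 (odd part of the Kubo corrector `≫ N^{3/2}` in `L²`); cycle 3 adds
  the MODE-COUPLING reading of why it does not happen: slow ODD observables of a pinned chain are beats
  `q_k p_l − q_l p_k` of nearly degenerate normal-mode pairs (frequency `Δω ≍ 1/N`, contact damping `≍ γ/N`),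
  whose bookkeeping at the harmonic corner is the exact `K_N = N/6 − 2/9` (extensive, no band-edge `N²`);
  anharmonic scattering only dephases them faster (rate `1/τ_mfp ≫ γ/N` once `N ≫ ℓ`).  Energy-diffusion modes
  (rate `D/N²`) are EVEN and Dirichlet-suppressed at the contacts (amplitude `≍ 1/N` on the bath sites), which is
  why even `‖h_even‖²` stays extensive rather than `≍ N³`.
* **Scaling symmetry recorded** (exact, from `(q,p) ↦ (aq,ap)`): `K_N(T; lam, β) = K_N(1; lam·T, β·T)/T²`, so the
  crux's `C = C(T)` is forced to blow up like `T⁻²` as `T → 0` (harmonic limit `κ_odd N/T²`) and a temperature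
  scan is an anharmonicity scan — used to design the cycle-3 numerics.
* **Numerics (kit, this seat)**: branching-MD estimator of `K_N = ½D(w)` for the ANHARMONIC chain (identity
  `K_N = A_N − B_N = ½E[(I − Ĩ)(I′ − Ĩ′)]`, four conditionally independent branches from `X₀ ~ μ_T` and `ΘX₀`;
  harmonic validation against `2/9, 0.4694, 0.7809, 1.1114`; also `‖k_τ‖²` vs the Clausius budget and `G_N` from
  `∫C_gg = (γ/2T²)(1 − 2G_N/γ)`): smoke job j012250, full scan `lam = β ∈ {0, 0.3, 1, 3}`, `N ∈ {2,4,6,8}` in the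
  follow-up job (ids and the table in §10's addendum / NOTES when they return; summaries auto-attach to the item).

## Landed through the gate (importable by ideators / planners / provers)

* `Summits/…/Theorems/ExtensiveSnapshotIrreversibility/Negative/LoadBearingHypotheses.lean`
  (p72584, ACCEPTED): `extensiveSnapshotIrreversibility_false_without_family`,
  `extensiveSnapshotIrreversibility_false_with_T_nonneg`, `klDiv_dirac_flip_eq_top`.
* `Summits/…/Theorems/ExtensiveSnapshotIrreversibility/Negative/DegenerateInstances.lean`
  (p72631, ACCEPTED): `gibbsMeasure_map_flip` (any `OscillatorChain`), `klDiv_flip_gibbsMeasure`,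
  `klDiv_flip_zero_sites`, `extensiveSnapshotIrreversibility_bound_at_zero/_at_one`,
  `eventually_bath_temps_pos`.
* cycle 2: `…/Negative/FamilyIndependence.lean` (p73896, ACCEPTED):
  `extensiveSnapshotIrreversibility_family_eventuallyEq/_concl_iff_of_uniq/_concl_of_exists_family/
  _perBond_iff_perSite`; `…/Negative/SnapshotFunctional.lean` (p74977, ACCEPTED):
  `klDiv_flip_symm`, `klDiv_flip_eq_top_of_atom`, `extensiveSnapshotIrreversibility_obstruction_tvRegular`,
  `klDiv_flip_ge_odd_variational`, `sq_integral_odd_le_klDiv_flip`;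
  `…/Negative/TiltedCriterion.lean` (p75997, ACCEPTED): `map_flip_tilted`, `llr_tilted_flip`,
  `klDiv_flip_tilted_ne_top_iff`, `toReal_klDiv_flip_tilted`, `klDiv_flip_tilted_le_integral_sq`,
  `klDiv_flip_gibbs_tilted_le`; `…/Negative/TiltedFloor.lean` (proposal pending gate):
  `klDiv_flip_tilted_ge_integral_sq_exp`.
* kit job j009975 (queued, farm saturated): branching-MD estimate of `K_N, A_N, B_N` for the
  ANHARMONIC `pinnedChain 1 1 1 1`, `T = 1`, `N = 2,3,4,6` (estimator and harmonic validation in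
  the job script `kn_branching.py`; results → `results.json`, to be folded in at the next cycle).

## What is proved in this file (all sorry-free unless marked)

0. `crux_iff` — the crux restated through `UniqAt / IsFamily / Concl / snapKL` (`Iff.rfl`).
1. `snapKL_dirac_of_ne` — a point mass off `Fix Θ` has `KL(δ_z ‖ Θ_*δ_z) = ∞`;
   `not_eventually_snapKL_dirac_le` — hence no eventual finite bound at a point mass.
2. Degenerate instances HOLD: `snapKL_zero_sites` (`N = 0`: `Θ = id`, `KL = 0`),
   `gibbsMeasure_map_flip` (Gibbs measure is `Θ`-invariant), `snapKL_gibbsMeasure = 0`,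
   `bound_at_one` (`N = 1`: under the crux hypotheses the steady state is Gibbs at the mean
   temperature, `KL = 0`).  So a counterexample needs `N ≥ 2`.
3. LOAD-BEARING ANALYSIS:
   * `false_without_family` (`NessUnique →`) and `false_without_uniq_family` (unconditional):
     dropping "μ is a steady-state family" is fatal (Dirac family).
   * `false_without_Tpos` (`NessUnique →`) and `false_without_uniq_Tpos` (unconditional):
     `0 < T` cannot be dropped, nor weakened to `0 ≤ T` (at `T = 0` one bath temperature
     `T ± δ/2` is `≤ 0` for every `δ ≠ 0`, where the family is unconstrained).
   * `0 < γ`: NOT a place for a counterexample — at `γ = 0` the generator ignores `T_L, T_R` and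
     every Gibbs measure is steady (`pinnedChain_integral_generator_gibbsMeasure` with `P.γ = 0`),
     so `UniqAt` fails and the instance is vacuous (`isSteadyState_gibbs_of_gamma_zero` below).
   * `0 < lam`, `0 < β`: dropping them admits the harmonic corner where the bound still holds
     numerically (`K_N ≈ 0.16N`); not load-bearing for a refutation, load-bearing for the
     intended *proof* only through NESS existence/uniqueness technology (CEHR C5 needs `β > 0`).
4. NATURAL STRENGTHENINGS (documented, not decidable here): `K_N = O(1)` (true diffusively, false
   at the harmonic corner — excluded); `C` uniform in `T` (false: `K_N ∝ T⁻²` at the harmonic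
   corner, and the anharmonic chain is asymptotically harmonic as `T → 0`); `o(δ²)` (false as soon
   as `D_N ≠ 0`, by the Cauchy–Schwarz floor).

5. REDUCTIONS (§5): `concl_iff_of_uniq`, `crux_iff_exists_family`, `concl_iff_nonneg_const`,
   `perBond_iff_perSite`.
6. SNAPSHOT FUNCTIONAL (§6): `snapKL_symm`, `snapKL_eq_top_of_atom`, `obstruction_tvRegular`,
   `snapKL_ge_odd_variational`, `sq_integral_odd_le_snapKL`.
7. SIBLING INTERFACE (§7): `IsResponseDensity`, `ResponseDensity'`, `ReversalKLSecondOrder'`,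
   `SnapshotKLFinite`, `OddResponseLinear`, `crux_of_responseDensity` — (K) from the fixed-`N`
   items of `OddSectorIrreversibility` plus the `O(N)` bound on `½‖h − h∘Θ‖²`;
   `OddDensityIsCorrector'`, `CorrectorOddCubicBound`, `oddResponseLinear_of_corrector`,
   `crux_of_correctorBound` — (K) from `∫(u − u∘Θ)² dμ_T ≤ C·N³` on the Kubo corrector.
8. (prose) strategy ledger.
9. TILTED CRITERION (§9): `map_flip_tilted`, `llr_tilted_flip`, `klDiv_flip_tilted_ne_top_iff`,
   `toReal_klDiv_flip_tilted`, the SANDWICH `klDiv_flip_tilted_ge_integral_sq_exp` /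
   `klDiv_flip_tilted_le_integral_sq` (`½∫d²e^{-d/2}dμ ≤ KL ≤ ∫d²dμ`), `OddLogDensityBound`,
   `crux_of_oddLogDensityBound`.
10. TARGETS (§10, cycle 3): verdict table for the seven stubs of `clausius-budget-sound-window`;
   `uniqAt_of_not_crux` (formal shield), `neg_mul_sq_add_mul_le`, `clausius_rate_le` (S3b's constant),
   `le_mul_of_hasDerivAt_le`, `normSq_le_of_dissipation` (abstract Clausius budget = exact shape of S3b),
   `le_of_eventually_sq_sandwich`, `lateShape_of_lower_expansion` (`(K) ⟹ S4` needs the lower expansion).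

Targets: payload `stuck_stubs` / `targets` empty at cycles 1–2 (no line picked yet); at cycle 3 the line
`clausius-budget-sound-window` is PICKED and its seven stubs are pre-screened in §10 (none false as filed;
`stuck_stubs` still empty — the lead is at cycle 0).
-/

namespace Summit.AtomisticToContinuum.FouriersLaw.Cruxes.ExtensiveSnapshotIrreversibility.Disproof

open MeasureTheory Filter Topology InformationTheory
open scoped ENNReal
open Literature.MathematicalPhysics.KineticTheory.HeatConduction
open Summit.AtomisticToContinuum.FouriersLaw.Theses.BondHeatUncertainty

noncomputable section

/-! ## 0. The crux with named pieces -/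

/-- A family of candidate steady states indexed by `N, T_L, T_R`. -/
abbrev Family : Type := (N : ℕ) → ℝ → ℝ → Measure (PhaseSpace N)

/-- Snapshot irreversibility `KL(μ ‖ Θ_* μ)`, `Θ(q,p) = (q,-p)` (literally the crux's term). -/
def snapKL {N : ℕ} (μ : Measure (PhaseSpace N)) : ℝ≥0∞ :=
  klDiv μ (Measure.map (fun x : PhaseSpace N => (x.1, -x.2)) μ)

/-- Weak-NESS uniqueness at a parameter point (the crux's guard; = `NessUnique` specialised). -/
def UniqAt (ω₂ lam β γ : ℝ) : Prop :=
  ∀ (N : ℕ) (T_L T_R : ℝ), 0 < T_L → 0 < T_R →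
    ∀ μ ν : Measure (PhaseSpace N),
      (pinnedChain ω₂ lam β γ).IsSteadyState N T_L T_R μ →
      (pinnedChain ω₂ lam β γ).IsSteadyState N T_L T_R ν → μ = ν

/-- `μ` is a steady-state family of the chain at the parameter point. -/
def IsFamily (ω₂ lam β γ : ℝ) (μ : Family) : Prop :=
  ∀ (N : ℕ) (T_L T_R : ℝ), 0 < T_L → 0 < T_R →
    (pinnedChain ω₂ lam β γ).IsSteadyState N T_L T_R (μ N T_L T_R)

/-- The crux's conclusion for a family at mean temperature `T`. -/
def Concl (μ : Family) (T : ℝ) : Prop :=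
  ∃ C : ℝ, ∀ N : ℕ, ∀ᶠ δ in 𝓝[≠] (0 : ℝ),
    snapKL (μ N (T + δ / 2) (T - δ / 2)) ≤ ENNReal.ofReal (C * (N : ℝ) * δ ^ 2)

/-- The crux is literally `∀ params > 0, UniqAt → ∀ μ, IsFamily μ → ∀ T > 0, Concl μ T`. -/
theorem crux_iff :
    ExtensiveSnapshotIrreversibility ↔
      ∀ ω₂ lam β γ : ℝ, 0 < ω₂ → 0 < lam → 0 < β → 0 < γ → UniqAt ω₂ lam β γ →
        ∀ μ : Family, IsFamily ω₂ lam β γ μ → ∀ T : ℝ, 0 < T → Concl μ T :=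
  Iff.rfl

/-- The guard is exactly the route's support item `NessUnique`, pointwise in the parameters. -/
theorem nessUnique_iff : NessUnique ↔ ∀ ω₂ lam β γ : ℝ, 0 < ω₂ → 0 < lam → 0 < β → 0 < γ →
    UniqAt ω₂ lam β γ := Iff.rfl

/-! ## 1. The snapshot functional at point masses -/

/-- The witness point `(q, p) = (0, 1)`: not fixed by `Θ` as soon as `N ≥ 1`. -/
def zbad (N : ℕ) : PhaseSpace N := (fun _ => 0, fun _ => 1)

theorem flip_zbad_ne {N : ℕ} (hN : 0 < N) : ((zbad N).1, -(zbad N).2) ≠ zbad N := by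
  intro h
  have h2 := congrArg (fun z : PhaseSpace N => z.2 ⟨0, hN⟩) h
  simp only [zbad, Pi.neg_apply] at h2
  norm_num at h2

/-- A point mass off the fixed-point set of `Θ` is singular to its flip: `KL = ∞`. -/
theorem snapKL_dirac_of_ne {N : ℕ} {z : PhaseSpace N} (hz : (z.1, -z.2) ≠ z) :
    snapKL (Measure.dirac z) = ∞ := by
  unfold snapKL
  have hm : Measurable (fun x : PhaseSpace N => (x.1, -x.2)) := (momentumReversal N).measurable
  rw [Measure.map_dirac' hm]
  refine klDiv_of_not_ac fun h => ?_
  have h0 : Measure.dirac (z.1, -z.2) {z} = 0 := by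
    rw [Measure.dirac_apply' _ (measurableSet_singleton z)]
    simp [Set.indicator, hz]
  have h1 := h h0
  simp at h1

/-- Hence no eventual finite bound can hold at such a point mass (the punctured filter is
non-trivial). -/
theorem not_eventually_snapKL_dirac_le {N : ℕ} {z : PhaseSpace N} (hz : (z.1, -z.2) ≠ z)
    (g : ℝ → ℝ≥0∞) (hg : ∀ δ, g δ ≠ ∞) :
    ¬ ∀ᶠ δ in 𝓝[≠] (0 : ℝ), snapKL (Measure.dirac z) ≤ g δ := by
  intro h
  obtain ⟨δ, hδ⟩ := h.exists
  rw [snapKL_dirac_of_ne hz, top_le_iff] at hδ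
  exact hg δ hδ

/-! ## 2. Degenerate instances hold: `N = 0`, `Θ`-invariant states, `N = 1` -/

/-- A `Θ`-invariant (σ-finite) state has zero snapshot irreversibility. -/
theorem snapKL_of_map_eq {N : ℕ} {μ : Measure (PhaseSpace N)} [SigmaFinite μ]
    (h : Measure.map (fun x : PhaseSpace N => (x.1, -x.2)) μ = μ) : snapKL μ = 0 := by
  unfold snapKL
  rw [h]
  exact klDiv_self μ

/-- `N = 0`: phase space is a point, `Θ = id`, `KL = 0` for every σ-finite `μ`. -/
theorem snapKL_zero_sites (μ : Measure (PhaseSpace 0)) [SigmaFinite μ] : snapKL μ = 0 := by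
  apply snapKL_of_map_eq
  have : (fun x : PhaseSpace 0 => (x.1, -x.2)) = id := funext fun x => Subsingleton.elim _ _
  rw [this, Measure.map_id]

/-- The Gibbs measure `Z⁻¹ e^{-H/T} dq dp` of ANY chain is `Θ`-invariant (`H` is even in `p`,
Lebesgue measure is `Θ`-invariant). -/
theorem gibbsMeasure_map_flip (P : OscillatorChain) (N : ℕ) (T : ℝ) :
    Measure.map (fun x : PhaseSpace N => (x.1, -x.2)) (P.gibbsMeasure N T) = P.gibbsMeasure N T := by
  have hf : ∀ x : PhaseSpace N, -P.hamiltonian N ((momentumReversal N) x) / T =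
      -P.hamiltonian N x / T := fun x => by
    rw [momentumReversal_apply, P.hamiltonian_neg_momentum]
  show Measure.map (momentumReversal N) (P.gibbsMeasure N T) = P.gibbsMeasure N T
  rw [P.gibbsMeasure_eq]
  conv_rhs => rw [← (measurePreserving_momentumReversal N).map_eq]
  ext s hs
  rw [Measure.map_apply (momentumReversal N).measurable hs,
    tilted_apply' _ _ ((momentumReversal N).measurable hs), tilted_apply' _ _ hs,
    integral_map_equiv, Measure.restrict_map (momentumReversal N).measurable hs,
    lintegral_map_equiv]
  simp only [hf]

/-- Hence the equilibrium state of the pinned chain has zero snapshot irreversibility. -/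
theorem snapKL_gibbsMeasure {ω₂ lam β : ℝ} (hω : 0 < ω₂) (hl : 0 ≤ lam) (hβ : 0 ≤ β) (γ : ℝ)
    (N : ℕ) {T : ℝ} (hT : 0 < T) : snapKL ((pinnedChain ω₂ lam β γ).gibbsMeasure N T) = 0 := by
  haveI := pinnedChain_isProbabilityMeasure_gibbsMeasure hω hl hβ γ N hT
  exact snapKL_of_map_eq (gibbsMeasure_map_flip _ N T)

/-- Both bath temperatures `T ± δ/2` are positive for `δ` near `0` (`T > 0`). -/
theorem eventually_temps_pos {T : ℝ} (hT : 0 < T) :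
    ∀ᶠ δ in 𝓝[≠] (0 : ℝ), 0 < T + δ / 2 ∧ 0 < T - δ / 2 := by
  have h2 : ∀ᶠ δ in 𝓝 (0 : ℝ), δ < 2 * T := eventually_lt_nhds (by linarith)
  have h2' : ∀ᶠ δ in 𝓝 (0 : ℝ), -(2 * T) < δ := eventually_gt_nhds (by linarith)
  filter_upwards [mem_nhdsWithin_of_mem_nhds h2, mem_nhdsWithin_of_mem_nhds h2'] with δ hlt hgt
  constructor <;> linarith

/-- `N = 0` instance of the crux's conclusion: holds for every family of steady states and every
constant `C` (both sides are `0`). -/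
theorem bound_at_zero {ω₂ lam β γ : ℝ} {μ : Family} (hμ : IsFamily ω₂ lam β γ μ) {T : ℝ}
    (hT : 0 < T) (C : ℝ) :
    ∀ᶠ δ in 𝓝[≠] (0 : ℝ),
      snapKL (μ 0 (T + δ / 2) (T - δ / 2)) ≤ ENNReal.ofReal (C * ((0 : ℕ) : ℝ) * δ ^ 2) := by
  filter_upwards [eventually_temps_pos hT] with δ hδ
  haveI := (hμ 0 _ _ hδ.1 hδ.2).1
  rw [snapKL_zero_sites]
  exact bot_le

/-- `N = 1` instance of the crux's conclusion: under the guard the steady state is the Gibbs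
measure at the mean temperature `T` (`pinnedChain_isSteadyState_gibbsMeasure_one`), which is
`Θ`-invariant, so `KL = 0 ≤ C δ²` for every `C`.  A counterexample therefore needs `N ≥ 2`. -/
theorem bound_at_one {ω₂ lam β γ : ℝ} (hω : 0 < ω₂) (hl : 0 < lam) (hβ : 0 < β)
    (hU : UniqAt ω₂ lam β γ) {μ : Family} (hμ : IsFamily ω₂ lam β γ μ) {T : ℝ} (hT : 0 < T)
    (C : ℝ) :
    ∀ᶠ δ in 𝓝[≠] (0 : ℝ),
      snapKL (μ 1 (T + δ / 2) (T - δ / 2)) ≤ ENNReal.ofReal (C * ((1 : ℕ) : ℝ) * δ ^ 2) := by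
  filter_upwards [eventually_temps_pos hT] with δ hδ
  have heq : μ 1 (T + δ / 2) (T - δ / 2) =
      (pinnedChain ω₂ lam β γ).gibbsMeasure 1 ((T + δ / 2 + (T - δ / 2)) / 2) :=
    hU 1 _ _ hδ.1 hδ.2 _ _ (hμ 1 _ _ hδ.1 hδ.2)
      (pinnedChain_isSteadyState_gibbsMeasure_one hω hl.le hβ.le γ hδ.1 hδ.2)
  have hT' : 0 < (T + δ / 2 + (T - δ / 2)) / 2 := by linarith
  rw [heq, snapKL_gibbsMeasure hω hl.le hβ.le γ 1 hT']
  exact bot_le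

/-! ## 3. Load-bearing analysis -/

/-- The crux WITHOUT the steady-state-family hypothesis (guard kept). -/
def WithoutFamily : Prop :=
  ∀ ω₂ lam β γ : ℝ, 0 < ω₂ → 0 < lam → 0 < β → 0 < γ → UniqAt ω₂ lam β γ →
    ∀ μ : Family, ∀ T : ℝ, 0 < T → Concl μ T

/-- The crux WITHOUT the family hypothesis AND without the guard. -/
def WithoutUniqFamily : Prop :=
  ∀ ω₂ lam β γ : ℝ, 0 < ω₂ → 0 < lam → 0 < β → 0 < γ →
    ∀ μ : Family, ∀ T : ℝ, 0 < T → Concl μ T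

/-- The crux WITHOUT `0 < T` (guard kept), i.e. the bound claimed at every mean temperature. -/
def WithoutTpos : Prop :=
  ∀ ω₂ lam β γ : ℝ, 0 < ω₂ → 0 < lam → 0 < β → 0 < γ → UniqAt ω₂ lam β γ →
    ∀ μ : Family, IsFamily ω₂ lam β γ μ → ∀ T : ℝ, Concl μ T

/-- The crux with `0 < T` weakened to `0 ≤ T` (guard kept). -/
def WithTnonneg : Prop :=
  ∀ ω₂ lam β γ : ℝ, 0 < ω₂ → 0 < lam → 0 < β → 0 < γ → UniqAt ω₂ lam β γ →
    ∀ μ : Family, IsFamily ω₂ lam β γ μ → ∀ T : ℝ, 0 ≤ T → Concl μ T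

/-- Same two, guard dropped as well (unconditionally refutable). -/
def WithoutUniqTpos : Prop :=
  ∀ ω₂ lam β γ : ℝ, 0 < ω₂ → 0 < lam → 0 < β → 0 < γ →
    ∀ μ : Family, IsFamily ω₂ lam β γ μ → ∀ T : ℝ, 0 ≤ T → Concl μ T

/-- The Dirac family: every `(N, T_L, T_R)` gets the point mass at `zbad N`. -/
def diracFamily : Family := fun N _ _ => Measure.dirac (zbad N)

/-- The Dirac family violates the conclusion at every `T` (look at `N = 1`). -/
theorem not_concl_diracFamily (T : ℝ) : ¬ Concl diracFamily T := by
  rintro ⟨C, hC⟩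
  exact not_eventually_snapKL_dirac_le (flip_zbad_ne Nat.one_pos) _
    (fun δ => ENNReal.ofReal_ne_top) (hC 1)

/-- **Load-bearing: the family hypothesis** (unconditional form, guard dropped too). -/
theorem false_without_uniq_family : ¬ WithoutUniqFamily := fun h =>
  not_concl_diracFamily 1 (h 1 1 1 1 one_pos one_pos one_pos one_pos diracFamily 1 one_pos)

/-- **Load-bearing: the family hypothesis** (guard kept; conditional on the route's own
`NessUnique`, without which no instance of the guard is available). -/
theorem false_without_family (hNU : NessUnique) : ¬ WithoutFamily := fun h =>
  not_concl_diracFamily 1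
    (h 1 1 1 1 one_pos one_pos one_pos one_pos (hNU 1 1 1 1 one_pos one_pos one_pos one_pos)
      diracFamily 1 one_pos)

/-- A genuine steady-state family at positive temperatures (CEHR 2018 existence, proved in tree),
extended by the bad point mass at non-positive temperatures, where `IsFamily` asks nothing. -/
def patchedFamily (ω₂ lam β γ : ℝ) (hω : 0 < ω₂) (hl : 0 < lam) (hβ : 0 < β) (hγ : 0 < γ) :
    Family := fun N T_L T_R =>
  if h : 0 < T_L ∧ 0 < T_R then
    Classical.choose (pinnedChain_exists_isSteadyState hω hl hβ hγ N h.1 h.2)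
  else Measure.dirac (zbad N)

theorem isFamily_patchedFamily {ω₂ lam β γ : ℝ} (hω : 0 < ω₂) (hl : 0 < lam) (hβ : 0 < β)
    (hγ : 0 < γ) : IsFamily ω₂ lam β γ (patchedFamily ω₂ lam β γ hω hl hβ hγ) := by
  intro N T_L T_R hL hR
  simp only [patchedFamily, dif_pos (And.intro hL hR)]
  exact Classical.choose_spec (pinnedChain_exists_isSteadyState hω hl hβ hγ N hL hR)

/-- At mean temperature `T = 0` one of `T ± δ/2` is non-positive for EVERY `δ`, so the patched
family is the bad point mass there. -/
theorem patchedFamily_at_zero {ω₂ lam β γ : ℝ} (hω : 0 < ω₂) (hl : 0 < lam) (hβ : 0 < β)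
    (hγ : 0 < γ) (N : ℕ) (δ : ℝ) :
    patchedFamily ω₂ lam β γ hω hl hβ hγ N (0 + δ / 2) (0 - δ / 2) = Measure.dirac (zbad N) := by
  have h : ¬ (0 < 0 + δ / 2 ∧ 0 < 0 - δ / 2) := fun h => by linarith [h.1, h.2]
  simp only [patchedFamily, dif_neg h]

theorem not_concl_patchedFamily_zero {ω₂ lam β γ : ℝ} (hω : 0 < ω₂) (hl : 0 < lam) (hβ : 0 < β)
    (hγ : 0 < γ) : ¬ Concl (patchedFamily ω₂ lam β γ hω hl hβ hγ) 0 := by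
  rintro ⟨C, hC⟩
  have h1 := hC 1
  simp only [patchedFamily_at_zero] at h1
  exact not_eventually_snapKL_dirac_le (flip_zbad_ne Nat.one_pos) _
    (fun δ => ENNReal.ofReal_ne_top) h1

/-- **Load-bearing: `0 < T`, even against the weakening `0 ≤ T`** (unconditional form). -/
theorem false_without_uniq_Tpos : ¬ WithoutUniqTpos := fun h =>
  not_concl_patchedFamily_zero one_pos one_pos one_pos one_pos
    (h 1 1 1 1 one_pos one_pos one_pos one_pos _
      (isFamily_patchedFamily one_pos one_pos one_pos one_pos) 0 le_rfl)

/-- **Load-bearing: `0 < T` cannot be weakened to `0 ≤ T`** (guard kept; needs `NessUnique`). -/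
theorem false_with_T_nonneg (hNU : NessUnique) : ¬ WithTnonneg := fun h =>
  not_concl_patchedFamily_zero one_pos one_pos one_pos one_pos
    (h 1 1 1 1 one_pos one_pos one_pos one_pos (hNU 1 1 1 1 one_pos one_pos one_pos one_pos) _
      (isFamily_patchedFamily one_pos one_pos one_pos one_pos) 0 le_rfl)

/-- **Load-bearing: `0 < T` cannot be dropped** (guard kept; needs `NessUnique`). -/
theorem false_without_Tpos (hNU : NessUnique) : ¬ WithoutTpos := fun h =>
  not_concl_patchedFamily_zero one_pos one_pos one_pos one_pos
    (h 1 1 1 1 one_pos one_pos one_pos one_pos (hNU 1 1 1 1 one_pos one_pos one_pos one_pos) _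
      (isFamily_patchedFamily one_pos one_pos one_pos one_pos) 0)

/-- Natural strengthening: the bound for ALL `δ ≠ 0` instead of eventually (guard dropped). -/
def WithAllDelta : Prop :=
  ∀ ω₂ lam β γ : ℝ, 0 < ω₂ → 0 < lam → 0 < β → 0 < γ →
    ∀ μ : Family, IsFamily ω₂ lam β γ μ → ∀ T : ℝ, 0 < T →
      ∃ C : ℝ, ∀ N : ℕ, ∀ δ : ℝ, δ ≠ 0 →
        snapKL (μ N (T + δ / 2) (T - δ / 2)) ≤ ENNReal.ofReal (C * (N : ℝ) * δ ^ 2)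

/-- **The `∀ᶠ δ` (equivalently a window `|δ| < 2T`) cannot be replaced by `∀ δ ≠ 0`:** at
`δ = 4T` the right bath temperature `T - δ/2 = -T` is negative, where a steady-state family is
unconstrained (patched family, `T = 1`, `δ = 4`, `N = 1`). -/
theorem false_withAllDelta : ¬ WithAllDelta := by
  intro h
  obtain ⟨C, hC⟩ := h 1 1 1 1 one_pos one_pos one_pos one_pos _
    (isFamily_patchedFamily one_pos one_pos one_pos one_pos) 1 one_pos
  have h1 := hC 1 4 (by norm_num)
  have hbad : patchedFamily 1 1 1 1 one_pos one_pos one_pos one_pos 1 (1 + 4 / 2) (1 - 4 / 2) =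
      Measure.dirac (zbad 1) := by
    have hn : ¬ (0 < (1 : ℝ) + 4 / 2 ∧ 0 < (1 : ℝ) - 4 / 2) := fun h => by linarith [h.2]
    simp only [patchedFamily, dif_neg hn]
  rw [hbad, snapKL_dirac_of_ne (flip_zbad_ne Nat.one_pos), top_le_iff] at h1
  exact ENNReal.ofReal_ne_top h1

/-! ## 4. Natural strengthenings (status recorded; none decidable in Lean today)

* `StrengtheningBounded` (`K_N = O(1)`, what diffusive phenomenology predicts for `lam, β > 0`):
  cannot be refuted for the crux's parameters; FALSE at the excluded harmonic corner
  (`K_N ≈ 0.16·N/T²`, exact Gaussian numerics, kit j007816) — so any proof of the crux that does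
  not use `lam > 0 ∨ β > 0` proves at most the extensive bound, never `O(1)`.
* `StrengtheningUniformT` (`C` independent of `T`): FALSE in substance — harmonic corner
  `K_N(T) = K_N(1)/T²` exactly (the Gaussian NESS covariance is linear in the bath temperatures,
  so `KL` depends on `δ/T` only), and the anharmonic chain is asymptotically harmonic as `T → 0`
  (Barrier `LowTemperatureWeakAnharmonicity`); not provable here (needs the NESS).
* `o(δ²)` instead of `O(δ²)`: FALSE as soon as the response `D_N ≠ 0` (Cauchy–Schwarz floor
  `K_N ≥ 2D_N²/‖Σ_b j_b‖²`); not provable here (needs `D_N ≠ 0`, i.e. PositiveConductance).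
-/

/-- Strengthening (K_N bounded): same hypotheses, conclusion `KL ≤ C δ²` uniformly in `N`. -/
def StrengtheningBounded : Prop :=
  ∀ ω₂ lam β γ : ℝ, 0 < ω₂ → 0 < lam → 0 < β → 0 < γ → UniqAt ω₂ lam β γ →
    ∀ μ : Family, IsFamily ω₂ lam β γ μ → ∀ T : ℝ, 0 < T →
      ∃ C : ℝ, ∀ N : ℕ, ∀ᶠ δ in 𝓝[≠] (0 : ℝ),
        snapKL (μ N (T + δ / 2) (T - δ / 2)) ≤ ENNReal.ofReal (C * δ ^ 2)

/-- Strengthening (`C` uniform in `T`). -/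
def StrengtheningUniformT : Prop :=
  ∀ ω₂ lam β γ : ℝ, 0 < ω₂ → 0 < lam → 0 < β → 0 < γ → UniqAt ω₂ lam β γ →
    ∀ μ : Family, IsFamily ω₂ lam β γ μ → ∃ C : ℝ, ∀ T : ℝ, 0 < T →
      ∀ N : ℕ, ∀ᶠ δ in 𝓝[≠] (0 : ℝ),
        snapKL (μ N (T + δ / 2) (T - δ / 2)) ≤ ENNReal.ofReal (C * (N : ℝ) * δ ^ 2)

/-- The strengthenings imply the crux (so refuting the crux refutes them; not conversely). -/
theorem crux_of_strengtheningBounded (h : StrengtheningBounded) :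
    ExtensiveSnapshotIrreversibility := by
  rw [crux_iff]
  intro ω₂ lam β γ hω hl hβ hγ hU μ hμ T hT
  obtain ⟨C, hC⟩ := h ω₂ lam β γ hω hl hβ hγ hU μ hμ T hT
  refine ⟨max C 0, fun N => ?_⟩
  rcases Nat.eq_zero_or_pos N with rfl | hN
  · exact bound_at_zero hμ hT _
  · filter_upwards [hC N] with δ hδ
    refine hδ.trans (ENNReal.ofReal_le_ofReal ?_)
    have h1 : (1 : ℝ) ≤ N := by exact_mod_cast hN
    have hδ2 : 0 ≤ δ ^ 2 := sq_nonneg δ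
    have hm0 : 0 ≤ max C 0 := le_max_right _ _
    calc C * δ ^ 2 ≤ max C 0 * δ ^ 2 := mul_le_mul_of_nonneg_right (le_max_left _ _) hδ2
      _ = max C 0 * 1 * δ ^ 2 := by ring
      _ ≤ max C 0 * (N : ℝ) * δ ^ 2 :=
          mul_le_mul_of_nonneg_right (mul_le_mul_of_nonneg_left h1 hm0) hδ2

theorem crux_of_strengtheningUniformT (h : StrengtheningUniformT) :
    ExtensiveSnapshotIrreversibility := by
  rw [crux_iff]
  intro ω₂ lam β γ hω hl hβ hγ hU μ hμ T hT
  obtain ⟨C, hC⟩ := h ω₂ lam β γ hω hl hβ hγ hU μ hμ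
  exact ⟨C, hC T hT⟩

/-- **`0 < γ` is not where a counterexample can live.**  At `γ = 0` the generator does not see
the bath temperatures, so every Gibbs measure `μ_{T'}`, `T' > 0`, is a weak steady state for every
nominal `(T_L, T_R)`: the guard `UniqAt ω₂ lam β 0` can only hold if all these Gibbs measures
coincide, i.e. the `γ = 0` instance of the crux is vacuous rather than false. -/
theorem isSteadyState_gibbs_of_gamma_zero {ω₂ lam β : ℝ} (hω : 0 < ω₂) (hl : 0 ≤ lam)
    (hβ : 0 ≤ β) (N : ℕ) {T' : ℝ} (hT' : 0 < T') (T_L T_R : ℝ) :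
    (pinnedChain ω₂ lam β 0).IsSteadyState N T_L T_R ((pinnedChain ω₂ lam β 0).gibbsMeasure N T') := by
  obtain ⟨hprob, -, hint⟩ := pinnedChain_isSteadyState_gibbsMeasure hω hl hβ 0 N hT'
  refine ⟨hprob, fun f hf hfc => ?_, hint⟩
  rw [pinnedChain_integral_generator_gibbsMeasure ω₂ lam β 0 N T' T_L T_R (hf.of_le (by norm_cast))
    hfc]
  simp [pinnedChain]

/-! ## 5. Reductions (cycle 2): family independence, one family suffices, `C ≥ 0`, normalisation -/

/-- Under the guard two steady-state families agree along `T ± δ/2` for `δ` near `0`. -/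
theorem family_eventuallyEq {ω₂ lam β γ : ℝ} (hU : UniqAt ω₂ lam β γ) {μ ν : Family}
    (hμ : IsFamily ω₂ lam β γ μ) (hν : IsFamily ω₂ lam β γ ν) {T : ℝ} (hT : 0 < T) (N : ℕ) :
    ∀ᶠ δ in 𝓝[≠] (0 : ℝ), μ N (T + δ / 2) (T - δ / 2) = ν N (T + δ / 2) (T - δ / 2) := by
  filter_upwards [eventually_temps_pos hT] with δ hδ
  exact hU N _ _ hδ.1 hδ.2 _ _ (hμ N _ _ hδ.1 hδ.2) (hν N _ _ hδ.1 hδ.2)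

/-- **Family independence**: under the guard, `Concl μ T ↔ Concl ν T` for steady-state families. -/
theorem concl_iff_of_uniq {ω₂ lam β γ : ℝ} (hU : UniqAt ω₂ lam β γ) {μ ν : Family}
    (hμ : IsFamily ω₂ lam β γ μ) (hν : IsFamily ω₂ lam β γ ν) {T : ℝ} (hT : 0 < T) :
    Concl μ T ↔ Concl ν T := by
  constructor <;> rintro ⟨C, hC⟩ <;> refine ⟨C, fun N => ?_⟩
  · filter_upwards [hC N, family_eventuallyEq hU hμ hν hT N] with δ h1 h2
    rw [← h2]; exact h1
  · filter_upwards [hC N, family_eventuallyEq hU hμ hν hT N] with δ h1 h2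
    rw [h2]; exact h1

/-- **One family suffices** (existential form of the crux): under the guard the universal
quantifier over steady-state families carries no content — a prover may work with the CEHR
invariant measures, a refuter with any convenient family. -/
theorem crux_iff_exists_family :
    ExtensiveSnapshotIrreversibility ↔
      ∀ ω₂ lam β γ : ℝ, 0 < ω₂ → 0 < lam → 0 < β → 0 < γ → UniqAt ω₂ lam β γ →
        ∃ μ : Family, IsFamily ω₂ lam β γ μ ∧ ∀ T : ℝ, 0 < T → Concl μ T := by
  rw [crux_iff]
  constructor
  · intro h ω₂ lam β γ hω hl hβ hγ hU
    exact ⟨_, isFamily_patchedFamily hω hl hβ hγ,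
      fun T hT => h ω₂ lam β γ hω hl hβ hγ hU _ (isFamily_patchedFamily hω hl hβ hγ) T hT⟩
  · intro h ω₂ lam β γ hω hl hβ hγ hU μ hμ T hT
    obtain ⟨ν, hν, hC⟩ := h ω₂ lam β γ hω hl hβ hγ hU
    exact (concl_iff_of_uniq hU hμ hν hT).2 (hC T hT)

/-- **`C ≥ 0` without loss** (at `N = 0` both sides vanish; for `N ≥ 1` a negative `C` clips the
right-hand side to `0`, which only strengthens the bound). -/
theorem concl_iff_nonneg_const (μ : Family) (T : ℝ) :
    Concl μ T ↔ ∃ C : ℝ, 0 ≤ C ∧ ∀ N : ℕ, ∀ᶠ δ in 𝓝[≠] (0 : ℝ),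
      snapKL (μ N (T + δ / 2) (T - δ / 2)) ≤ ENNReal.ofReal (C * (N : ℝ) * δ ^ 2) := by
  constructor
  · rintro ⟨C, hC⟩
    refine ⟨max C 0, le_max_right _ _, fun N => ?_⟩
    filter_upwards [hC N] with δ hδ
    refine hδ.trans (ENNReal.ofReal_le_ofReal ?_)
    have hδ2 : 0 ≤ δ ^ 2 := sq_nonneg δ
    have hN : (0 : ℝ) ≤ N := Nat.cast_nonneg N
    nlinarith [mul_nonneg (mul_nonneg (sub_nonneg.2 (le_max_left C 0)) hN) hδ2]
  · rintro ⟨C, -, hC⟩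
    exact ⟨C, hC⟩

/-- **Normalisation robustness**: per-bond (`C·(N−1)`) and per-site (`C·N`) bounds are equivalent
under the crux hypotheses (the `N = 0, 1` instances hold with constant `0`). -/
theorem perBond_iff_perSite {ω₂ lam β γ : ℝ} (hω : 0 < ω₂) (hl : 0 < lam) (hβ : 0 < β)
    (hU : UniqAt ω₂ lam β γ) {μ : Family} (hμ : IsFamily ω₂ lam β γ μ) {T : ℝ} (hT : 0 < T) :
    (∃ C : ℝ, ∀ N : ℕ, ∀ᶠ δ in 𝓝[≠] (0 : ℝ),
      snapKL (μ N (T + δ / 2) (T - δ / 2)) ≤ ENNReal.ofReal (C * ((N : ℝ) - 1) * δ ^ 2)) ↔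
    Concl μ T := by
  constructor
  · rintro ⟨C, hC⟩
    refine ⟨max C 0, fun N => ?_⟩
    rcases Nat.eq_zero_or_pos N with rfl | hN
    · exact bound_at_zero hμ hT _
    · filter_upwards [hC N] with δ hδ
      refine hδ.trans (ENNReal.ofReal_le_ofReal ?_)
      have h1 : (1 : ℝ) ≤ N := by exact_mod_cast hN
      have hδ2 : 0 ≤ δ ^ 2 := sq_nonneg δ
      have hm : C ≤ max C 0 := le_max_left _ _
      have hm0 : 0 ≤ max C 0 := le_max_right _ _
      nlinarith [mul_nonneg hm0 hδ2, mul_nonneg (sub_nonneg.2 hm)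
        (mul_nonneg (by linarith : (0:ℝ) ≤ (N:ℝ) - 1) hδ2)]
  · rintro ⟨C, hC⟩
    refine ⟨2 * max C 0, fun N => ?_⟩
    rcases Nat.lt_or_ge N 2 with hN | hN
    · interval_cases N
      · filter_upwards [bound_at_zero hμ hT 0] with δ hδ
        exact hδ.trans (by simp)
      · filter_upwards [bound_at_one hω hl hβ hU hμ hT 0] with δ hδ
        exact hδ.trans (by simp)
    · filter_upwards [hC N] with δ hδ
      refine hδ.trans (ENNReal.ofReal_le_ofReal ?_)
      have h2 : (2 : ℝ) ≤ N := by exact_mod_cast hN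
      have hδ2 : 0 ≤ δ ^ 2 := sq_nonneg δ
      have hm : C ≤ max C 0 := le_max_left _ _
      have hm0 : 0 ≤ max C 0 := le_max_right _ _
      nlinarith [mul_nonneg hm0 hδ2, mul_nonneg (sub_nonneg.2 hm)
        (mul_nonneg (by linarith : (0:ℝ) ≤ (N:ℝ)) hδ2),
        mul_nonneg (mul_nonneg hm0 (by linarith : (0:ℝ) ≤ (N:ℝ) - 2)) hδ2]

/-- **The guard is logically inert given `NessUnique`, and un-droppable without it**: with the
route's `NessUnique` in hand the guarded crux and the unguarded one coincide.  (Without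
`NessUnique` no instance of the guard is available, so no UNCONDITIONAL `¬` of any guarded
variant can be written — the standing obstruction to a Lean refutation recorded in cycle 1.) -/
theorem crux_iff_unguarded_of_nessUnique (hNU : NessUnique) :
    ExtensiveSnapshotIrreversibility ↔
      ∀ ω₂ lam β γ : ℝ, 0 < ω₂ → 0 < lam → 0 < β → 0 < γ →
        ∀ μ : Family, IsFamily ω₂ lam β γ μ → ∀ T : ℝ, 0 < T → Concl μ T := by
  rw [crux_iff]
  exact ⟨fun h ω₂ lam β γ hω hl hβ hγ => h ω₂ lam β γ hω hl hβ hγ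
      (hNU ω₂ lam β γ hω hl hβ hγ),
    fun h ω₂ lam β γ hω hl hβ hγ _ => h ω₂ lam β γ hω hl hβ hγ⟩

/-! ## 6. The snapshot functional (cycle 2): symmetry, singularity, TV-obstruction, odd floor -/

/-- Two flips give the identity (as push-forwards). -/
theorem map_flip_map_flip {N : ℕ} (μ : Measure (PhaseSpace N)) :
    Measure.map (fun x : PhaseSpace N => (x.1, -x.2))
        (Measure.map (fun x : PhaseSpace N => (x.1, -x.2)) μ) = μ := by
  have hm : Measurable (fun x : PhaseSpace N => (x.1, -x.2)) := (momentumReversal N).measurable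
  rw [Measure.map_map hm hm]
  have : ((fun x : PhaseSpace N => (x.1, -x.2)) ∘ (fun x : PhaseSpace N => (x.1, -x.2))) = id := by
    funext x
    simp
  rw [this, Measure.map_id]

/-- **Snapshot irreversibility is symmetric**: `KL(Θ_*μ ‖ μ) = KL(μ ‖ Θ_*μ)`. -/
theorem snapKL_symm {N : ℕ} (μ : Measure (PhaseSpace N)) [IsFiniteMeasure μ] :
    klDiv (Measure.map (fun x : PhaseSpace N => (x.1, -x.2)) μ) μ = snapKL μ := by
  unfold snapKL
  have h := klDiv_map_equiv (momentumReversal N) μ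
    (Measure.map (fun x : PhaseSpace N => (x.1, -x.2)) μ)
  have h2 : Measure.map (momentumReversal N)
      (Measure.map (fun x : PhaseSpace N => (x.1, -x.2)) μ) = μ := map_flip_map_flip μ
  rw [h2] at h
  exact h

/-- **An atom whose flip is not an atom forces `KL(μ ‖ Θ_*μ) = ∞`.** -/
theorem snapKL_eq_top_of_atom {N : ℕ} (μ : Measure (PhaseSpace N)) {z : PhaseSpace N}
    (hz : μ {z} ≠ 0) (hΘz : μ {(z.1, -z.2)} = 0) : snapKL μ = ∞ := by
  unfold snapKL
  have hm : Measurable (fun x : PhaseSpace N => (x.1, -x.2)) := (momentumReversal N).measurable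
  refine klDiv_of_not_ac fun h => hz (h ?_)
  rw [Measure.map_apply hm (measurableSet_singleton z)]
  have hset : (fun x : PhaseSpace N => (x.1, -x.2)) ⁻¹' {z} = {(z.1, -z.2)} := by
    ext x
    simp only [Set.mem_preimage, Set.mem_singleton_iff, Prod.ext_iff, neg_eq_iff_eq_neg]
  rw [hset]
  exact hΘz

/-- Points are Lebesgue-null in the phase space of `N ≥ 1` oscillators. -/
theorem volume_singleton_phaseSpace {N : ℕ} (hN : 0 < N) (z : PhaseSpace N) :
    (volume : Measure (PhaseSpace N)) {z} = 0 := by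
  haveI : Nonempty (Fin N) := ⟨⟨0, hN⟩⟩
  have : NullSingletonClass (volume : Measure (PhaseSpace N)) :=
    Measure.prod.instNullSingletonClass_fst
  exact measure_singleton z

/-- **Obstruction: TV-regularity of the response does not control the snapshot divergence.**
A `|δ|`-TV-Lipschitz family of probability measures at the flip-invariant Gibbs state whose
snapshot divergence is `∞` for every `δ ≠ 0` (atom of mass `|δ| ∧ 1` at `zbad 1`).  Not a
steady-state family — the point is methodological: bounded-observable / weak / TV linear response
(Hairer–Majda style differentiability of `δ ↦ μ_δ`) cannot give (K); density-level two-sided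
control is needed. -/
theorem obstruction_tvRegular :
    ∃ ν : ℝ → Measure (PhaseSpace 1),
      (∀ δ, IsProbabilityMeasure (ν δ)) ∧
      ν 0 = (pinnedChain 1 1 1 1).gibbsMeasure 1 1 ∧
      (∀ δ (s : Set (PhaseSpace 1)), |((ν δ) s).toReal - ((ν 0) s).toReal| ≤ |δ|) ∧
      ∀ δ, δ ≠ 0 → snapKL (ν δ) = ∞ := by
  set G : Measure (PhaseSpace 1) := (pinnedChain 1 1 1 1).gibbsMeasure 1 1 with hG
  haveI hGp : IsProbabilityMeasure G :=
    pinnedChain_isProbabilityMeasure_gibbsMeasure one_pos zero_le_one zero_le_one 1 1 one_pos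
  set w : ℝ → ℝ := fun δ => min |δ| 1 with hw
  have hw0 : ∀ δ, 0 ≤ w δ := fun δ => le_min (abs_nonneg δ) zero_le_one
  have hw1 : ∀ δ, w δ ≤ 1 := fun δ => min_le_right _ _
  have hwδ : ∀ δ, w δ ≤ |δ| := fun δ => min_le_left _ _
  set ν : ℝ → Measure (PhaseSpace 1) := fun δ =>
    ENNReal.ofReal (1 - w δ) • G + ENNReal.ofReal (w δ) • Measure.dirac (zbad 1) with hν
  have hνapply : ∀ δ (s : Set (PhaseSpace 1)),
      ν δ s = ENNReal.ofReal (1 - w δ) * G s + ENNReal.ofReal (w δ) * Measure.dirac (zbad 1) s := by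
    intro δ s
    simp [hν]
  have hν0 : ν 0 = G := by
    have : w 0 = 0 := by simp [hw]
    simp [hν, this]
  refine ⟨ν, fun δ => ?_, hν0, fun δ s => ?_, fun δ hδ => ?_⟩
  · constructor
    rw [hνapply, measure_univ, measure_univ, mul_one, mul_one,
      ← ENNReal.ofReal_add (by linarith [hw1 δ]) (hw0 δ)]
    simp
  · rw [hν0, hνapply]
    have hGs : (G s).toReal ≤ 1 := by
      have := ENNReal.toReal_mono ENNReal.one_ne_top (prob_le_one (μ := G) (s := s))
      simpa using this
    have hGs0 : 0 ≤ (G s).toReal := ENNReal.toReal_nonneg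
    have hDs : (Measure.dirac (zbad 1) s).toReal ≤ 1 := by
      have := ENNReal.toReal_mono ENNReal.one_ne_top
        (prob_le_one (μ := Measure.dirac (zbad 1)) (s := s))
      simpa using this
    have hDs0 : 0 ≤ (Measure.dirac (zbad 1) s).toReal := ENNReal.toReal_nonneg
    have hfin1 : ENNReal.ofReal (1 - w δ) * G s ≠ ∞ :=
      ENNReal.mul_ne_top ENNReal.ofReal_ne_top (measure_ne_top G s)
    have hfin2 : ENNReal.ofReal (w δ) * Measure.dirac (zbad 1) s ≠ ∞ :=
      ENNReal.mul_ne_top ENNReal.ofReal_ne_top (measure_ne_top _ s)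
    rw [ENNReal.toReal_add hfin1 hfin2, ENNReal.toReal_mul, ENNReal.toReal_mul,
      ENNReal.toReal_ofReal (by linarith [hw1 δ]), ENNReal.toReal_ofReal (hw0 δ)]
    have key : (1 - w δ) * (G s).toReal + w δ * (Measure.dirac (zbad 1) s).toReal - (G s).toReal =
        w δ * ((Measure.dirac (zbad 1) s).toReal - (G s).toReal) := by ring
    rw [key, abs_mul, abs_of_nonneg (hw0 δ)]
    have hdiff : |(Measure.dirac (zbad 1) s).toReal - (G s).toReal| ≤ 1 := by
      rw [abs_le]; constructor <;> linarith
    calc w δ * |(Measure.dirac (zbad 1) s).toReal - (G s).toReal| ≤ w δ * 1 :=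
          mul_le_mul_of_nonneg_left hdiff (hw0 δ)
      _ ≤ |δ| := by rw [mul_one]; exact hwδ δ
  · have hwpos : 0 < w δ := lt_min (abs_pos.2 hδ) one_pos
    have hflip : (((zbad 1).1, -(zbad 1).2) : PhaseSpace 1) ≠ zbad 1 := flip_zbad_ne Nat.one_pos
    apply snapKL_eq_top_of_atom (ν δ) (z := zbad 1)
    · rw [hνapply]
      have h1 : Measure.dirac (zbad 1) {zbad 1} = 1 := by
        rw [Measure.dirac_apply' _ (measurableSet_singleton _)]; simp
      rw [h1, mul_one]
      have : 0 < ENNReal.ofReal (w δ) := ENNReal.ofReal_pos.2 hwpos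
      exact ne_of_gt (lt_of_lt_of_le this le_add_self)
    · rw [hνapply, (pinnedChain 1 1 1 1).gibbsMeasure_absolutelyContinuous 1 1
        (volume_singleton_phaseSpace Nat.one_pos _), mul_zero, zero_add]
      have h0 : Measure.dirac (zbad 1) {(((zbad 1).1, -(zbad 1).2) : PhaseSpace 1)} = 0 := by
        rw [Measure.dirac_apply' _ (measurableSet_singleton _)]
        simp [Set.indicator, Set.mem_singleton_iff, hflip.symm]
      rw [h0, mul_zero]

/-- Elementary: `e^{-y} - 1 ≤ -y + y²` for `|y| ≤ 1`. -/
theorem exp_neg_sub_one_le {y : ℝ} (hy : |y| ≤ 1) : Real.exp (-y) - 1 ≤ -y + y ^ 2 := by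
  have h := Real.abs_exp_sub_one_sub_id_le (x := -y) (by simpa using hy)
  have h' := (abs_le.mp h).2
  nlinarith [h']

/-- **The snapshot divergence dominates every bounded odd observable** (Donsker–Varadhan with the
odd test function, transported back by the flip; tree fact
`Literature.Probability.Divergences.integral_le_toReal_klDiv_add_integral`): for a finite measure
`μ` with `snapKL μ < ∞`, measurable `g` with `|g| ≤ 1`, `g ∘ Θ = −g`, and `0 ≤ λ ≤ 1`:
`2λ∫g dμ − λ²∫g² dμ ≤ snapKL μ`.  The `t → 0` end of (★). -/
theorem snapKL_ge_odd_variational {N : ℕ} (μ : Measure (PhaseSpace N)) [IsFiniteMeasure μ]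
    (hfin : snapKL μ ≠ ∞) {g : PhaseSpace N → ℝ} (hg : Measurable g) (hb : ∀ x, |g x| ≤ 1)
    (hodd : ∀ x : PhaseSpace N, g (x.1, -x.2) = -g x) {l : ℝ} (hl0 : 0 ≤ l) (hl1 : l ≤ 1) :
    2 * l * ∫ x, g x ∂μ - l ^ 2 * ∫ x, g x ^ 2 ∂μ ≤ (snapKL μ).toReal := by
  unfold snapKL at hfin ⊢
  have hm : Measurable (fun x : PhaseSpace N => (x.1, -x.2)) := (momentumReversal N).measurable
  set ν := Measure.map (fun x : PhaseSpace N => (x.1, -x.2)) μ with hν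
  have hlg_meas : Measurable fun x => l * g x := measurable_const.mul hg
  have hlg_bd : ∀ x, |l * g x| ≤ 1 := fun x => by
    rw [abs_mul, abs_of_nonneg hl0]
    calc l * |g x| ≤ 1 * 1 := mul_le_mul hl1 (hb x) (abs_nonneg _) zero_le_one
      _ = 1 := one_mul 1
  have hint_lg : Integrable (fun x => l * g x) μ :=
    Integrable.mono' (integrable_const (1 : ℝ)) hlg_meas.aestronglyMeasurable
      (ae_of_all _ fun x => by simpa [Real.norm_eq_abs] using hlg_bd x)
  have hexp_meas : Measurable fun x => Real.exp (l * g x) := hlg_meas.exp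
  have hexp_bd : ∀ x, |Real.exp (l * g x)| ≤ Real.exp 1 := fun x => by
    rw [abs_of_pos (Real.exp_pos _)]
    exact Real.exp_le_exp.mpr ((le_abs_self _).trans (hlg_bd x))
  have hint_exp : Integrable (fun x => Real.exp (l * g x)) ν :=
    Integrable.mono' (integrable_const (Real.exp 1)) hexp_meas.aestronglyMeasurable
      (ae_of_all _ fun x => by simpa [Real.norm_eq_abs] using hexp_bd x)
  have hDV := Literature.Probability.Divergences.integral_le_toReal_klDiv_add_integral hfin hint_lg
    hint_exp
  have hback : ∫ x, (Real.exp (l * g x) - 1) ∂ν = ∫ x, (Real.exp (-(l * g x)) - 1) ∂μ := by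
    rw [hν, integral_map hm.aemeasurable]
    · refine integral_congr_ae (ae_of_all _ fun x => ?_)
      simp only [hodd x, mul_neg]
    · exact ((hexp_meas.sub measurable_const).aestronglyMeasurable)
  have hpt : ∀ x, Real.exp (-(l * g x)) - 1 ≤ -(l * g x) + (l * g x) ^ 2 := fun x =>
    exp_neg_sub_one_le (hlg_bd x)
  have h1 : Integrable (fun x => -(l * g x)) μ := hint_lg.neg
  have h2 : Integrable (fun x => (l * g x) ^ 2) μ := by
    refine Integrable.mono' (integrable_const (1 : ℝ)) ((hlg_meas.pow_const 2).aestronglyMeasurable)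
      (ae_of_all _ fun x => ?_)
    have h1 := hlg_bd x
    rw [Real.norm_eq_abs, abs_pow]
    calc |l * g x| ^ 2 ≤ 1 ^ 2 := pow_le_pow_left₀ (abs_nonneg _) h1 2
      _ = 1 := one_pow 2
  have hint_rhs : Integrable (fun x => -(l * g x) + (l * g x) ^ 2) μ := h1.add h2
  have hint_lhs : Integrable (fun x => Real.exp (-(l * g x)) - 1) μ := by
    refine Integrable.mono' (integrable_const (Real.exp 1 + 1)) ?_ (ae_of_all _ fun x => ?_)
    · exact ((hlg_meas.neg.exp).sub measurable_const).aestronglyMeasurable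
    · rw [Real.norm_eq_abs]
      have h1 : |Real.exp (-(l * g x))| ≤ Real.exp 1 := by
        rw [abs_of_pos (Real.exp_pos _)]
        refine Real.exp_le_exp.mpr ((le_abs_self _).trans ?_)
        rw [abs_neg]; exact hlg_bd x
      calc |Real.exp (-(l * g x)) - 1| ≤ |Real.exp (-(l * g x))| + |(1 : ℝ)| := abs_sub _ _
        _ ≤ Real.exp 1 + 1 := by rw [abs_one]; linarith
  have hmono : ∫ x, (Real.exp (-(l * g x)) - 1) ∂μ ≤ ∫ x, (-(l * g x) + (l * g x) ^ 2) ∂μ :=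
    integral_mono hint_lhs hint_rhs hpt
  have hsplit : ∫ x, (-(l * g x) + (l * g x) ^ 2) ∂μ =
      -(l * ∫ x, g x ∂μ) + l ^ 2 * ∫ x, g x ^ 2 ∂μ := by
    rw [integral_add h1 h2, integral_neg, integral_const_mul]
    simp_rw [mul_pow]
    rw [integral_const_mul]
  have hlin : ∫ x, l * g x ∂μ = l * ∫ x, g x ∂μ := integral_const_mul _ _
  rw [hlin] at hDV
  rw [hback] at hDV
  linarith [hDV, hmono, hsplit]

/-- **Corollary (Cauchy–Schwarz floor, abstract form)**: `(∫ g dμ)² ≤ snapKL μ` for measurable odd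
`g` with `|g| ≤ 1` on a probability space.  Along the NESS `∫ g dμ_δ = δ·(response of g) + o(δ)`,
so `K_N ≥ (response)²`: snapshot irreversibility is at least the square of ANY bounded odd linear
response — `≍ N` at a ballistic point (`D_N ≍ N`), `≍ 1/N` diffusively.  This is why `o(δ²)` and
`o(N)` versions of the crux are false at the (excluded) harmonic corner, and why the exponent `1`
in `C·N` is the least one compatible with it. -/
theorem sq_integral_odd_le_snapKL {N : ℕ} (μ : Measure (PhaseSpace N)) [IsProbabilityMeasure μ]
    (hfin : snapKL μ ≠ ∞) {g : PhaseSpace N → ℝ} (hg : Measurable g) (hb : ∀ x, |g x| ≤ 1)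
    (hodd : ∀ x : PhaseSpace N, g (x.1, -x.2) = -g x) :
    (∫ x, g x ∂μ) ^ 2 ≤ (snapKL μ).toReal := by
  wlog hpos : 0 ≤ ∫ x, g x ∂μ generalizing g
  · have h := this (g := fun x => -g x) hg.neg (fun x => by simpa using hb x)
      (fun x => by simp [hodd x]) (by rw [integral_neg]; linarith [le_of_not_ge hpos])
    simpa [integral_neg] using h
  set m := ∫ x, g x ∂μ with hm
  have hm1 : m ≤ 1 := by
    have : ∫ x, g x ∂μ ≤ ∫ x, (1 : ℝ) ∂μ := by
      refine integral_mono ?_ (integrable_const 1) fun x => (le_abs_self _).trans (hb x)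
      exact Integrable.mono' (integrable_const (1 : ℝ)) hg.aestronglyMeasurable
        (ae_of_all _ fun x => by simpa [Real.norm_eq_abs] using hb x)
    simpa using this
  have hV1 : ∫ x, g x ^ 2 ∂μ ≤ 1 := by
    have : ∫ x, g x ^ 2 ∂μ ≤ ∫ x, (1 : ℝ) ∂μ := by
      refine integral_mono ?_ (integrable_const 1) fun x => ?_
      · exact Integrable.mono' (integrable_const (1 : ℝ)) ((hg.pow_const 2).aestronglyMeasurable)
          (ae_of_all _ fun x => by
            rw [Real.norm_eq_abs, abs_pow]
            calc |g x| ^ 2 ≤ 1 ^ 2 := pow_le_pow_left₀ (abs_nonneg _) (hb x) 2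
              _ = 1 := one_pow 2)
      · calc g x ^ 2 = |g x| ^ 2 := (sq_abs _).symm
          _ ≤ 1 ^ 2 := pow_le_pow_left₀ (abs_nonneg _) (hb x) 2
          _ = 1 := one_pow 2
    simpa using this
  have hV0 : 0 ≤ ∫ x, g x ^ 2 ∂μ := integral_nonneg fun x => sq_nonneg _
  have key := snapKL_ge_odd_variational μ hfin hg hb hodd hpos hm1
  rw [← hm] at key
  nlinarith [key, hV1, hV0, sq_nonneg m]

/-! ## 7. The sibling route's fixed-`N` interface: (K) = response density + second-order KL +
finiteness + an `O(N)` bound; and (K) below the Kubo-corrector scale (cycle 2)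

Route `OddSectorIrreversibility` (open, volatile: rev 6 on 2026-08-16 dropped `ReversalKLSecondOrder`
and replaced its engine by `ConeScaleCorrector`) files the fixed-`N` McLennan/KDN bookkeeping as
items: `ResponseDensity` (9144: `h ∈ L²(μ_{N,T,T})`, the weak `δ`-derivative of the family),
`ReversalKLSecondOrder` (9145, RETIRED 2026-08-16: `KL(μ_δ‖Θμ_δ)/δ² → ½∫(h − h∘Θ)²`),
`OddDensityIsCorrector` (9146: `h − h∘Θ = (u − u∘Θ)/((N−1)T²)`, `u = ∫₀^∞ P_t J_tot`), the crux
`OddResponseBound` (9140: `N·∫(h−hΘ)² ≤ C`) and the new engine `ConeScaleCorrector` (E1: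
`∫ u² dμ_T ≤ C·N²`, normalised).  To stay robust against renames the statements used below are
LOCAL verbatim copies (primed names).  OUR crux needs only `½∫(h−hΘ)² ≤ C·N` — weaker than 9140 by
`N²` — i.e. `∫ (u − u∘Θ)² dμ_T ≤ C·N³` — weaker than E1 by a factor `N` and satisfied even by the
ballistic harmonic member (`≍ N³`, E1's own "fails as it must" benchmark).  The theorems below make
this precise and isolate the finiteness of the divergence, which 9145 (typed through `toReal`)
never carried.  Consequences: (i) every line for (K) contains the three fixed-`N` stubs; (ii) a
refutation of (K) refutes 9140 AND E1 a fortiori; (iii) if E1 lands, (K) costs only the fixed-`N`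
stubs. -/

/-- The linear-response-density interface of route `OddSectorIrreversibility` (verbatim body of the
hypothesis in items 9140/9145/9146, conclusion of 9144). -/
def IsResponseDensity (ω₂ lam β γ : ℝ) (μ : Family) (T : ℝ) (N : ℕ) (h : PhaseSpace N → ℝ) :
    Prop :=
  MemLp h 2 (μ N T T) ∧
  (∀ F : PhaseSpace N → ℝ, ContDiff ℝ ((⊤ : ℕ∞) : WithTop ℕ∞) F → HasCompactSupport F →
    Tendsto (fun δ : ℝ => ((∫ x, F x ∂(μ N (T + δ / 2) (T - δ / 2))) - ∫ x, F x ∂(μ N T T)) / δ)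
      (𝓝[≠] 0) (𝓝 (∫ x, F x * h x ∂(μ N T T)))) ∧
  (∀ i : Fin N, Tendsto (fun δ : ℝ =>
    ((∫ x, (pinnedChain ω₂ lam β γ).bondCurrent N i x ∂(μ N (T + δ / 2) (T - δ / 2))) -
      ∫ x, (pinnedChain ω₂ lam β γ).bondCurrent N i x ∂(μ N T T)) / δ)
      (𝓝[≠] 0) (𝓝 (∫ x, (pinnedChain ω₂ lam β γ).bondCurrent N i x * h x ∂(μ N T T))))

/-- Local copy of sibling item 9144 `ResponseDensity` (existence of the response density). -/
def ResponseDensity' : Prop :=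
  ∀ ω₂ lam β γ : ℝ, 0 < ω₂ → 0 < lam → 0 < β → 0 < γ → UniqAt ω₂ lam β γ →
    ∀ μ : Family, IsFamily ω₂ lam β γ μ → ∀ T : ℝ, 0 < T → ∀ N : ℕ,
      ∃ h : PhaseSpace N → ℝ, IsResponseDensity ω₂ lam β γ μ T N h

/-- Local copy of the RETIRED sibling item 9145 `ReversalKLSecondOrder`:
`KL(μ_δ ‖ Θμ_δ).toReal/δ² → ½∫(h − h∘Θ)²` (junk-tolerant for `KL = ⊤`, see `SnapshotKLFinite`). -/
def ReversalKLSecondOrder' : Prop :=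
  ∀ ω₂ lam β γ : ℝ, 0 < ω₂ → 0 < lam → 0 < β → 0 < γ → UniqAt ω₂ lam β γ →
    ∀ μ : Family, IsFamily ω₂ lam β γ μ → ∀ T : ℝ, 0 < T → ∀ (N : ℕ) (h : PhaseSpace N → ℝ),
      IsResponseDensity ω₂ lam β γ μ T N h →
        Tendsto (fun δ : ℝ => (snapKL (μ N (T + δ / 2) (T - δ / 2))).toReal / δ ^ 2)
          (𝓝[≠] 0) (𝓝 ((1 / 2 : ℝ) * ∫ x, (h x - h (x.1, -x.2)) ^ 2 ∂(μ N T T)))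

/-- Fixed-`N` finiteness of the snapshot divergence along the family (the unprinted piece:
two-sided NESS density control; by §9 EXACTLY `φ_δ − φ_δ∘Θ ∈ L¹(μ_δ)`).  NOT implied by
`ReversalKLSecondOrder'` as typed. -/
def SnapshotKLFinite : Prop :=
  ∀ ω₂ lam β γ : ℝ, 0 < ω₂ → 0 < lam → 0 < β → 0 < γ → UniqAt ω₂ lam β γ →
    ∀ μ : Family, IsFamily ω₂ lam β γ μ → ∀ T : ℝ, 0 < T → ∀ N : ℕ,
      ∀ᶠ δ in 𝓝[≠] (0 : ℝ), snapKL (μ N (T + δ / 2) (T - δ / 2)) ≠ ∞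

/-- **The `N`-uniform content of (K) at the level of the response density**, for `N ≥ 2`:
`½‖h − h∘Θ‖² ≤ C·N` (`OddResponseBound` 9140 weakened by the factor `N²`). -/
def OddResponseLinear : Prop :=
  ∀ ω₂ lam β γ : ℝ, 0 < ω₂ → 0 < lam → 0 < β → 0 < γ → UniqAt ω₂ lam β γ →
    ∀ μ : Family, IsFamily ω₂ lam β γ μ → ∀ T : ℝ, 0 < T →
      ∃ C : ℝ, ∀ (N : ℕ) (h : PhaseSpace N → ℝ), 2 ≤ N → IsResponseDensity ω₂ lam β γ μ T N h →
        (1 / 2 : ℝ) * ∫ x, (h x - h (x.1, -x.2)) ^ 2 ∂(μ N T T) ≤ C * N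

/-- **(K) from the fixed-`N` items plus the `O(N)` bound** (sorry-free glue):
`ResponseDensity' → ReversalKLSecondOrder' → SnapshotKLFinite → OddResponseLinear → (K)`.
Proof: `N = 0, 1` by `bound_at_zero/_at_one`; at `N ≥ 2`, `KL.toReal/δ² → ½∫(h−hΘ)² ≤ CN < (C+1)N`,
so eventually `KL.toReal < (C+1)Nδ²`, and finiteness turns `toReal` back into `KL`. -/
theorem crux_of_responseDensity (hR : ResponseDensity') (hKL : ReversalKLSecondOrder')
    (hfin : SnapshotKLFinite) (hlin : OddResponseLinear) : ExtensiveSnapshotIrreversibility := by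
  rw [crux_iff]
  intro ω₂ lam β γ hω hl hβ hγ hU μ hμ T hT
  obtain ⟨C, hC⟩ := hlin ω₂ lam β γ hω hl hβ hγ hU μ hμ T hT
  refine ⟨max (C + 1) 0, fun N => ?_⟩
  rcases Nat.lt_or_ge N 2 with hN | hN
  · interval_cases N
    · exact bound_at_zero hμ hT _
    · exact bound_at_one hω hl hβ hU hμ hT _
  obtain ⟨h, hh⟩ := hR ω₂ lam β γ hω hl hβ hγ hU μ hμ T hT N
  have hlim := hKL ω₂ lam β γ hω hl hβ hγ hU μ hμ T hT N h hh
  have hle : (1 / 2 : ℝ) * ∫ x, (h x - h (x.1, -x.2)) ^ 2 ∂(μ N T T) ≤ C * N := hC N h hN hh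
  have hNpos : (0 : ℝ) < N := by exact_mod_cast (lt_of_lt_of_le (by norm_num) hN)
  have hlt : (1 / 2 : ℝ) * ∫ x, (h x - h (x.1, -x.2)) ^ 2 ∂(μ N T T) < max (C + 1) 0 * N := by
    have : (C + 1) * N ≤ max (C + 1) 0 * N := mul_le_mul_of_nonneg_right (le_max_left _ _) hNpos.le
    nlinarith
  have hev : ∀ᶠ δ in 𝓝[≠] (0 : ℝ),
      (snapKL (μ N (T + δ / 2) (T - δ / 2))).toReal / δ ^ 2 < max (C + 1) 0 * N :=
    hlim.eventually (gt_mem_nhds hlt)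
  have hδne : ∀ᶠ δ in 𝓝[≠] (0 : ℝ), δ ≠ 0 := self_mem_nhdsWithin
  filter_upwards [hev, hδne, hfin ω₂ lam β γ hω hl hβ hγ hU μ hμ T hT N] with δ h1 h2 h3
  have hδ2 : 0 < δ ^ 2 := by positivity
  rw [div_lt_iff₀ hδ2] at h1
  rw [← ENNReal.ofReal_toReal h3]
  exact ENNReal.ofReal_le_ofReal (by nlinarith)

/-- Local copy of sibling item 9146 `OddDensityIsCorrector` (McLennan/KDN identity at fixed
`N ≥ 2`): the odd part of the response density is the odd part of the Kubo corrector of the total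
current, divided by `(N−1)T²`. -/
def OddDensityIsCorrector' : Prop :=
  ∀ ω₂ lam β γ : ℝ, 0 < ω₂ → 0 < lam → 0 < β → 0 < γ → UniqAt ω₂ lam β γ →
    ∀ μ : Family, IsFamily ω₂ lam β γ μ → ∀ T : ℝ, 0 < T → ∀ (N : ℕ) (h : PhaseSpace N → ℝ),
      2 ≤ N → IsResponseDensity ω₂ lam β γ μ T N h →
        ∃ u : PhaseSpace N → ℝ, MemLp u 2 (μ N T T) ∧
          (∀ᵐ x ∂(μ N T T), Tendsto (fun τ : ℝ => ∫ t in Set.Ioc (0 : ℝ) τ,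
            (∫ y, (∑ i : Fin N, (pinnedChain ω₂ lam β γ).bondCurrent N i y)
              ∂((pinnedChain ω₂ lam β γ).transitionKernel N T T t.toNNReal x)))
                atTop (𝓝 (u x))) ∧
          (∀ᵐ x ∂(μ N T T), h x - h (x.1, -x.2) = (u x - u (x.1, -x.2)) / (((N : ℝ) - 1) * T ^ 2))

/-- **What (K) asks of the Kubo corrector**: `∫ (u − u∘Θ)² dμ_{N,T,T} ≤ C·N³` for every
a.e.-limit `u` of the finite-horizon correctors (`N ≥ 2`).  Compare the sibling engine
`ConeScaleCorrector` (E1): `∫ u² dμ_T ≤ C·N²` — stronger by a factor `N` (and by dropping the odd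
projection); the ballistic harmonic member has `∫u² ≍ N³` and still satisfies THIS bound. -/
def CorrectorOddCubicBound : Prop :=
  ∀ ω₂ lam β γ : ℝ, 0 < ω₂ → 0 < lam → 0 < β → 0 < γ → UniqAt ω₂ lam β γ →
    ∀ μ : Family, IsFamily ω₂ lam β γ μ → ∀ T : ℝ, 0 < T →
      ∃ C : ℝ, ∀ (N : ℕ) (u : PhaseSpace N → ℝ), 2 ≤ N → MemLp u 2 (μ N T T) →
        (∀ᵐ x ∂(μ N T T), Tendsto (fun τ : ℝ => ∫ t in Set.Ioc (0 : ℝ) τ,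
          (∫ y, (∑ i : Fin N, (pinnedChain ω₂ lam β γ).bondCurrent N i y)
            ∂((pinnedChain ω₂ lam β γ).transitionKernel N T T t.toNNReal x)))
              atTop (𝓝 (u x))) →
        ∫ x, (u x - u (x.1, -x.2)) ^ 2 ∂(μ N T T) ≤ C * (N : ℝ) ^ 3

/-- **The `O(N)` bound on the odd response density from the cubic corrector bound**
(`OddDensityIsCorrector' → CorrectorOddCubicBound → OddResponseLinear`):
`½∫(h−hΘ)² = ½∫(u−uΘ)²/((N−1)²T⁴) ≤ C N³/(2(N−1)²T⁴) ≤ 2C N/T⁴` for `N ≥ 2`. -/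
theorem oddResponseLinear_of_corrector (hD : OddDensityIsCorrector') (hB : CorrectorOddCubicBound) :
    OddResponseLinear := by
  intro ω₂ lam β γ hω hl hβ hγ hU μ hμ T hT
  obtain ⟨C, hC⟩ := hB ω₂ lam β γ hω hl hβ hγ hU μ hμ T hT
  refine ⟨2 * max C 0 / T ^ 4, fun N h hN hh => ?_⟩
  obtain ⟨u, hu2, hlimu, hrel⟩ := hD ω₂ lam β γ hω hl hβ hγ hU μ hμ T hT N h hN hh
  have hbound := hC N u hN hu2 hlimu
  have hN1 : (1 : ℝ) ≤ (N : ℝ) - 1 := by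
    have : (2 : ℝ) ≤ N := by exact_mod_cast hN
    linarith
  have hT2 : 0 < T ^ 2 := by positivity
  have hT4 : 0 < T ^ 4 := by positivity
  have hden : 0 < ((N : ℝ) - 1) * T ^ 2 := by positivity
  -- rewrite the integrand a.e.
  have hcongr : ∫ x, (h x - h (x.1, -x.2)) ^ 2 ∂(μ N T T) =
      ∫ x, (u x - u (x.1, -x.2)) ^ 2 / (((N : ℝ) - 1) * T ^ 2) ^ 2 ∂(μ N T T) := by
    refine integral_congr_ae ?_
    filter_upwards [hrel] with x hx
    rw [hx, div_pow]
  rw [hcongr, integral_div]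
  set I := ∫ x, (u x - u (x.1, -x.2)) ^ 2 ∂(μ N T T) with hIdef
  have hI0 : 0 ≤ I := integral_nonneg fun x => sq_nonneg _
  have hC0 : C * (N : ℝ) ^ 3 ≤ max C 0 * (N : ℝ) ^ 3 :=
    mul_le_mul_of_nonneg_right (le_max_left _ _) (by positivity)
  have hm0 : 0 ≤ max C 0 := le_max_right _ _
  have hI : I ≤ max C 0 * (N : ℝ) ^ 3 := hbound.trans hC0
  have hsq : ((N : ℝ)) ^ 2 ≤ 4 * ((N : ℝ) - 1) ^ 2 := by nlinarith
  have hNpos : (0 : ℝ) < N := by linarith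
  have hD : (((N : ℝ) - 1) * T ^ 2) ^ 2 = ((N : ℝ) - 1) ^ 2 * T ^ 4 := by ring
  rw [hD]
  have hDpos : 0 < ((N : ℝ) - 1) ^ 2 * T ^ 4 := by positivity
  rw [show (1 / 2 : ℝ) * (I / (((N : ℝ) - 1) ^ 2 * T ^ 4)) = (I / 2) / (((N : ℝ) - 1) ^ 2 * T ^ 4) by
    ring]
  rw [div_le_iff₀ hDpos]
  have hT4ne : T ^ 4 ≠ 0 := hT4.ne'
  have hrhs : 2 * max C 0 / T ^ 4 * ↑N * (((N : ℝ) - 1) ^ 2 * T ^ 4) =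
      2 * max C 0 * ↑N * ((N : ℝ) - 1) ^ 2 := by
    field_simp
  rw [hrhs]
  nlinarith [mul_le_mul_of_nonneg_left hsq (mul_nonneg hm0 hNpos.le), hI, hI0]

/-- **(K) below the Kubo-corrector scale**: the full chain
`ResponseDensity' → ReversalKLSecondOrder' → SnapshotKLFinite → OddDensityIsCorrector' →
CorrectorOddCubicBound → (K)`. -/
theorem crux_of_correctorBound (hR : ResponseDensity') (hKL : ReversalKLSecondOrder')
    (hfin : SnapshotKLFinite) (hD : OddDensityIsCorrector') (hB : CorrectorOddCubicBound) :
    ExtensiveSnapshotIrreversibility :=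
  crux_of_responseDensity hR hKL hfin (oddResponseLinear_of_corrector hD hB)

/-! ## 8. Proof-strategy ledger (cycle 2; prose, for ideators/planners)

* EXCLUDED: `‖h^odd‖ ≤ ‖s‖/gap_N` (gap `≲ γ/N`, `N⁻³` harmonic — Barrier
  `BeckerMenegaki2022_gapClosing`); measure-level response theory alone (§6 obstruction);
  path-space data processing against the equilibrium path measure (mutually singular: different
  noise intensities) or against `Θ̃P_δ` (returns `σt + KL(μ‖Θμ) ≥ KL(μ‖Θμ)`, no information).
* SUFFICIENT, with room: `∫₀^∞ ‖P_t J_tot‖_{L²(μ_T)} dt ≤ C N^{3/2}` (triangle inequality on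
  `u = ∫P_tJ`, then §7); any polynomial `L²(μ_T)`-decay `‖P_t J_tot‖ ≤ C‖J‖(1+t/N)^{-1-ε}`;
  `A_N = ‖(−L_T)⁻¹ s‖² = O(N)` ("extensive Fisher information of the NESS family at `δ = 0`",
  since `K_N ≤ K_N + 2‖h^even‖² = 2A_N`) — expected both ballistically (`A ≈ N/12`) and
  diffusively (`A ≈ N c_v/12T²` from the linear profile).
* WHERE A COUNTEREXAMPLE WOULD HAVE TO LIVE: fixed `N ≥ 2` with `KL(μ_δ‖Θμ_δ) = ∞` or not
  `O(δ²)` (needs a PROOF of heavy log-ratio tails of the NESS density — no handle; Gibbs-type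
  upper tails are printed, Rey-Bellet–Thomas 2002; the borderline `k₁ = k₂ = 4` degrees of
  `pinnedChain` are inside their hypotheses, Hairer 2009's heavy tails need `k₁ > k₂`); or
  `‖P_odd u_N‖² ≫ N³` at fixed parameters (no mechanism, see the header).* NEAREST PRINTED APPEARANCE OF THE OBJECT (cycle 3 literature pass; openalex/s2 429, crossref ok):
  the snapshot log-ratio `ψ(x) = ln P^st(x)/P^st(εx)` is Spinney–Ford's "transient housekeeping"
  potential — `ΔS_3 = Σ_i ln[P^st(x_{i−1})P^st(εx_i)/(P^st(x_i)P^st(εx_{i−1}))]`, a telescoping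
  boundary term with `⟨dΔS_3/dτ⟩^{st} = 0` (PRL 108, 170603 (2012) = arXiv:1201.0904, eq. after
  (S2IFT), read pp. 4–5), and Lee–Kwon–Park PRL 110, 050602 (2013); `⟨ψ⟩_{st} = KL(P^st‖P^st∘ε)` is
  exactly the crux's snapshot KL.  Stochastic thermodynamics knows the object and that its
  stationary INCREMENT averages to zero; nobody estimates its SIZE, let alone its `N`-scaling in an
  extended system — consistent with the grounders' "nothing to vendor".
-/


/-! ## 9. The tilted (log-density) criterion (cycle 2): exact finiteness, value, and an
`L²(μ_δ)` sufficient condition with NO `δ`-expansion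

Write the steady state as `μ_δ = μ_T.tilted φ_δ` (`φ_δ = log dμ_δ/dμ_T`, McLennan form; possible
whenever `μ_δ ≪ μ_T` with a.e.-positive density).  With `d := φ_δ − φ_δ∘Θ`:
`KL(μ_δ ‖ Θμ_δ) < ∞ ↔ d ∈ L¹(μ_δ)` (EXACT — where a fixed-`N` counterexample must live),
`KL = ∫ d dμ_δ`, and the SANDWICH `½∫ d² e^{−d/2} dμ_δ ≤ KL ≤ ∫ d² dμ_δ`.  So (K) follows from
`∫ (φ_δ − φ_δ∘Θ)² dμ_δ ≤ C·N·δ²` eventually (`crux_of_oddLogDensityBound`): an `L²` bound on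
the odd part of the NESS log-density under the NESS itself — no second-order expansion, no
limit `δ → 0`, no lower density bound beyond positivity.  Heuristically `φ_δ ≈ δ h`, `d ≈ 2δ h^odd`,
`∫d² dμ_δ ≈ 4δ²‖h^odd‖²` (a factor `2` above the sharp `2δ²‖h^odd‖²`).  Landed candidate:
`Negative/TiltedCriterion.lean`. -/

open Real
/-- pointwise: `(a - b)(e^a - e^b) ≤ (a - b)²(e^a + e^b)`. -/
theorem sub_mul_exp_sub_exp_le (a b : ℝ) :
    (a - b) * (exp a - exp b) ≤ (a - b) ^ 2 * (exp a + exp b) := by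
  have ha := exp_pos a
  have hb := exp_pos b
  rcases le_total b a with h | h
  · -- `e^a - e^b ≤ (a - b) e^a`
    have h1 : exp a - exp b ≤ (a - b) * exp a := by
      have := add_one_le_exp (b - a)
      have h2 : exp b = exp a * exp (b - a) := by rw [← exp_add]; ring_nf
      nlinarith [mul_le_mul_of_nonneg_left this ha.le]
    have h3 : 0 ≤ a - b := sub_nonneg.2 h
    nlinarith [mul_le_mul_of_nonneg_left h1 h3, sq_nonneg (a - b), mul_nonneg (sq_nonneg (a-b)) hb.le]
  · have h1 : exp b - exp a ≤ (b - a) * exp b := by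
      have := add_one_le_exp (a - b)
      have h2 : exp a = exp b * exp (a - b) := by rw [← exp_add]; ring_nf
      nlinarith [mul_le_mul_of_nonneg_left this hb.le]
    have h3 : 0 ≤ b - a := sub_nonneg.2 h
    nlinarith [mul_le_mul_of_nonneg_left h1 h3, sq_nonneg (a - b), mul_nonneg (sq_nonneg (a-b)) ha.le]

variable {N : ℕ} (μ₀ : Measure (PhaseSpace N))

/-- invariance of integrals under the flip for a flip-invariant measure -/
theorem integral_comp_flip {E : Type*} [NormedAddCommGroup E] [NormedSpace ℝ E]
    (hinv : μ₀.map (fun x : PhaseSpace N => (x.1, -x.2)) = μ₀) (G : PhaseSpace N → E) :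
    ∫ x, G (x.1, -x.2) ∂μ₀ = ∫ x, G x ∂μ₀ := by
  have h := integral_map_equiv (momentumReversal N) G (μ := μ₀)
  have hinv' : Measure.map (momentumReversal N) μ₀ = μ₀ := hinv
  rw [hinv'] at h
  rw [h]
  rfl

theorem integrable_comp_flip_iff {E : Type*} [NormedAddCommGroup E]
    (hinv : μ₀.map (fun x : PhaseSpace N => (x.1, -x.2)) = μ₀) (G : PhaseSpace N → E) :
    Integrable (fun x => G (x.1, -x.2)) μ₀ ↔ Integrable G μ₀ := by
  have h := integrable_map_equiv (momentumReversal N) G (μ := μ₀)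
  have hinv' : Measure.map (momentumReversal N) μ₀ = μ₀ := hinv
  rw [hinv'] at h
  exact h.symm

/-- the normalising constants of `φ` and `φ ∘ Θ` agree -/
theorem integral_exp_comp_flip (hinv : μ₀.map (fun x : PhaseSpace N => (x.1, -x.2)) = μ₀)
    (φ : PhaseSpace N → ℝ) :
    ∫ x, exp (φ (x.1, -x.2)) ∂μ₀ = ∫ x, exp (φ x) ∂μ₀ :=
  integral_comp_flip μ₀ hinv (fun x => exp (φ x))

/-- **The flip of a tilted flip-invariant measure is the tilt by the flipped potential.** -/
theorem map_flip_tilted (hinv : μ₀.map (fun x : PhaseSpace N => (x.1, -x.2)) = μ₀)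
    {φ : PhaseSpace N → ℝ} (hφm : Measurable φ) :
    (μ₀.tilted φ).map (fun x : PhaseSpace N => (x.1, -x.2)) =
      μ₀.tilted (fun x => φ (x.1, -x.2)) := by
  have hm : Measurable (fun x : PhaseSpace N => (x.1, -x.2)) := (momentumReversal N).measurable
  ext s hs
  rw [Measure.map_apply hm hs, tilted_apply' _ _ (hm hs), tilted_apply' _ _ hs,
    integral_exp_comp_flip μ₀ hinv φ]
  set Z := ∫ x, exp (φ x) ∂μ₀
  have hf : Measurable fun a : PhaseSpace N => ENNReal.ofReal (exp (φ (a.1, -a.2)) / Z) :=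
    ((hφm.comp hm).exp.div_const Z).ennreal_ofReal
  -- rewrite μ₀ as the push-forward of itself on the right-hand side
  have h1 : ∫⁻ a in s, ENNReal.ofReal (exp (φ (a.1, -a.2)) / Z) ∂μ₀ =
      ∫⁻ a in s, ENNReal.ofReal (exp (φ (a.1, -a.2)) / Z)
        ∂(μ₀.map (fun x : PhaseSpace N => (x.1, -x.2))) := by rw [hinv]
  rw [h1, setLIntegral_map hs hf hm]
  refine setLIntegral_congr_fun (hm hs) (fun x _ => ?_)
  simp

variable {μ₀}

/-- a.e. log-likelihood ratio between the tilt and its flip: `φ - φ ∘ Θ` -/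
theorem llr_tilted_flip [IsProbabilityMeasure μ₀] (hinv : μ₀.map (fun x : PhaseSpace N => (x.1, -x.2)) = μ₀)
    {φ : PhaseSpace N → ℝ} (hφm : Measurable φ) (hexp : Integrable (fun x => exp (φ x)) μ₀) :
    llr (μ₀.tilted φ) (μ₀.tilted (fun x => φ (x.1, -x.2))) =ᵐ[μ₀]
      fun x => φ x - φ (x.1, -x.2) := by
  have hexp' : Integrable (fun x => exp (φ (x.1, -x.2))) μ₀ :=
    (integrable_comp_flip_iff μ₀ hinv (fun x => exp (φ x))).2 hexp
  have hac : μ₀ ≪ μ₀.tilted (fun x => φ (x.1, -x.2)) := absolutelyContinuous_tilted hexp'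
  have h1 := llr_tilted_left (μ := μ₀) (ν := μ₀.tilted (fun x => φ (x.1, -x.2))) (f := φ) hac
    hexp hφm.aemeasurable
  have h2 := llr_tilted_right (μ := μ₀) (ν := μ₀) (f := fun x => φ (x.1, -x.2))
    (Measure.AbsolutelyContinuous.rfl) hexp'
  have h3 := llr_self μ₀
  filter_upwards [h1, h2, h3] with x hx1 hx2 hx3
  rw [hx1, hx2, hx3, integral_exp_comp_flip μ₀ hinv φ]
  simp only [Pi.zero_apply]
  ring

/-- **Finiteness criterion.** For `μ = μ₀.tilted φ` with `μ₀` a flip-invariant probability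
measure: `KL(μ ‖ Θ_*μ) < ∞ ↔ φ - φ∘Θ ∈ L¹(μ)`. -/
theorem klDiv_flip_tilted_ne_top_iff [IsProbabilityMeasure μ₀] (hinv : μ₀.map (fun x : PhaseSpace N => (x.1, -x.2)) = μ₀)
    {φ : PhaseSpace N → ℝ} (hφm : Measurable φ) (hexp : Integrable (fun x => exp (φ x)) μ₀) :
    klDiv (μ₀.tilted φ) ((μ₀.tilted φ).map (fun x : PhaseSpace N => (x.1, -x.2))) ≠ ∞ ↔
      Integrable (fun x => φ x - φ (x.1, -x.2)) (μ₀.tilted φ) := by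
  have hexp' : Integrable (fun x => exp (φ (x.1, -x.2))) μ₀ :=
    (integrable_comp_flip_iff μ₀ hinv (fun x => exp (φ x))).2 hexp
  rw [map_flip_tilted μ₀ hinv hφm, klDiv_ne_top_iff]
  have hac : μ₀.tilted φ ≪ μ₀.tilted (fun x => φ (x.1, -x.2)) :=
    (tilted_absolutelyContinuous μ₀ φ).trans (absolutelyContinuous_tilted hexp')
  have hae := (tilted_absolutelyContinuous μ₀ φ).ae_le (llr_tilted_flip hinv hφm hexp)
  rw [integrable_congr hae]
  exact ⟨fun h => h.2, fun h => ⟨hac, h⟩⟩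

/-- **Value.** `KL(μ ‖ Θ_*μ) = ∫ (φ - φ∘Θ) dμ` (as `toReal`; both sides `0`-junk together). -/
theorem toReal_klDiv_flip_tilted [IsProbabilityMeasure μ₀] (hinv : μ₀.map (fun x : PhaseSpace N => (x.1, -x.2)) = μ₀)
    {φ : PhaseSpace N → ℝ} (hφm : Measurable φ) (hexp : Integrable (fun x => exp (φ x)) μ₀) :
    (klDiv (μ₀.tilted φ) ((μ₀.tilted φ).map (fun x : PhaseSpace N => (x.1, -x.2)))).toReal =
      ∫ x, (φ x - φ (x.1, -x.2)) ∂(μ₀.tilted φ) := by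
  have hexp' : Integrable (fun x => exp (φ (x.1, -x.2))) μ₀ :=
    (integrable_comp_flip_iff μ₀ hinv (fun x => exp (φ x))).2 hexp
  haveI : IsProbabilityMeasure (μ₀.tilted φ) := isProbabilityMeasure_tilted hexp
  haveI : IsProbabilityMeasure (μ₀.tilted (fun x => φ (x.1, -x.2))) :=
    isProbabilityMeasure_tilted hexp'
  rw [map_flip_tilted μ₀ hinv hφm]
  have hac : μ₀.tilted φ ≪ μ₀.tilted (fun x => φ (x.1, -x.2)) :=
    (tilted_absolutelyContinuous μ₀ φ).trans (absolutelyContinuous_tilted hexp')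
  rw [toReal_klDiv_of_measure_eq hac (by simp)]
  exact integral_congr_ae ((tilted_absolutelyContinuous μ₀ φ).ae_le (llr_tilted_flip hinv hφm hexp))

/-- **Snapshot KL is dominated by the second moment of the odd part of the log-density.**
For `μ = μ₀.tilted φ`, `μ₀` a flip-invariant probability measure, and `d := φ - φ∘Θ`:
if `d ∈ L²(μ)` then `KL(μ ‖ Θ_*μ) ≤ ∫ d² dμ` (and in particular is finite). -/
theorem klDiv_flip_tilted_le_integral_sq [IsProbabilityMeasure μ₀]
    (hinv : μ₀.map (fun x : PhaseSpace N => (x.1, -x.2)) = μ₀)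
    {φ : PhaseSpace N → ℝ} (hφm : Measurable φ) (hexp : Integrable (fun x => exp (φ x)) μ₀)
    (h2 : Integrable (fun x => (φ x - φ (x.1, -x.2)) ^ 2) (μ₀.tilted φ)) :
    klDiv (μ₀.tilted φ) ((μ₀.tilted φ).map (fun x : PhaseSpace N => (x.1, -x.2))) ≤
      ENNReal.ofReal (∫ x, (φ x - φ (x.1, -x.2)) ^ 2 ∂(μ₀.tilted φ)) := by
  set d : PhaseSpace N → ℝ := fun x => φ x - φ (x.1, -x.2) with hd
  have hdm : Measurable d := hφm.sub (hφm.comp (momentumReversal N).measurable)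
  have hdodd : ∀ x : PhaseSpace N, d (x.1, -x.2) = -d x := fun x => by
    simp [hd]
  -- `d ∈ L¹(μ)` from `d ∈ L²(μ)` (probability space): `|d| ≤ 1 + d²`
  haveI : IsProbabilityMeasure (μ₀.tilted φ) := isProbabilityMeasure_tilted hexp
  have h1 : Integrable d (μ₀.tilted φ) := by
    refine Integrable.mono' ((integrable_const (1 : ℝ)).add h2) hdm.aestronglyMeasurable
      (ae_of_all _ fun x => ?_)
    rw [Real.norm_eq_abs]
    change |d x| ≤ 1 + (d x) ^ 2
    rcases le_total |d x| 1 with h | h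
    · linarith [sq_nonneg (d x)]
    · have : |d x| ≤ |d x| ^ 2 := by nlinarith
      rw [sq_abs] at this; linarith
  -- finiteness, and the value as an integral
  have hfin : klDiv (μ₀.tilted φ) ((μ₀.tilted φ).map (fun x : PhaseSpace N => (x.1, -x.2))) ≠ ∞ :=
    (klDiv_flip_tilted_ne_top_iff hinv hφm hexp).2 h1
  rw [← ENNReal.ofReal_toReal hfin, toReal_klDiv_flip_tilted hinv hφm hexp]
  refine ENNReal.ofReal_le_ofReal ?_
  -- reduce to weighted `μ₀`-integrals
  set Z := ∫ x, exp (φ x) ∂μ₀ with hZ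
  have hZpos : 0 < Z := integral_exp_pos hexp
  have hw1 : Integrable (fun x => exp (φ x) * d x) μ₀ := by
    have := (integrable_tilted_iff hexp d).1 h1; simpa [smul_eq_mul] using this
  have hw2 : Integrable (fun x => exp (φ x) * d x ^ 2) μ₀ := by
    have := (integrable_tilted_iff hexp (fun x => d x ^ 2)).1 h2; simpa [smul_eq_mul] using this
  -- flipped weights, by invariance
  have hw1' : Integrable (fun x => exp (φ (x.1, -x.2)) * d x) μ₀ := by
    have h := (integrable_comp_flip_iff μ₀ hinv (fun x => -(exp (φ x) * d x))).2 hw1.neg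
    refine h.congr (ae_of_all _ fun x => ?_)
    simp only [hdodd x]; ring
  have hw2' : Integrable (fun x => exp (φ (x.1, -x.2)) * d x ^ 2) μ₀ := by
    have h := (integrable_comp_flip_iff μ₀ hinv (fun x => exp (φ x) * d x ^ 2)).2 hw2
    refine h.congr (ae_of_all _ fun x => ?_)
    simp only [hdodd x]; ring
  have hI1 : ∫ x, exp (φ (x.1, -x.2)) * d x ∂μ₀ = -∫ x, exp (φ x) * d x ∂μ₀ := by
    rw [← integral_neg, ← integral_comp_flip μ₀ hinv (fun x => -(exp (φ x) * d x))]
    refine integral_congr_ae (ae_of_all _ fun x => ?_)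
    simp only [hdodd x]; ring
  have hI2 : ∫ x, exp (φ (x.1, -x.2)) * d x ^ 2 ∂μ₀ = ∫ x, exp (φ x) * d x ^ 2 ∂μ₀ := by
    rw [← integral_comp_flip μ₀ hinv (fun x => exp (φ x) * d x ^ 2)]
    refine integral_congr_ae (ae_of_all _ fun x => ?_)
    simp only [hdodd x]; ring
  -- pointwise inequality `d (e^φ - e^{φΘ}) ≤ d² (e^φ + e^{φΘ})`, integrated
  have hpt : ∀ x, exp (φ x) * d x - exp (φ (x.1, -x.2)) * d x ≤
      exp (φ x) * d x ^ 2 + exp (φ (x.1, -x.2)) * d x ^ 2 := fun x => by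
    have := sub_mul_exp_sub_exp_le (φ x) (φ (x.1, -x.2))
    simp only [hd] at this ⊢
    nlinarith [this]
  have hint : ∫ x, (exp (φ x) * d x - exp (φ (x.1, -x.2)) * d x) ∂μ₀ ≤
      ∫ x, (exp (φ x) * d x ^ 2 + exp (φ (x.1, -x.2)) * d x ^ 2) ∂μ₀ :=
    integral_mono (hw1.sub hw1') (hw2.add hw2') hpt
  rw [integral_sub hw1 hw1', integral_add hw2 hw2', hI1, hI2] at hint
  -- so `∫ e^φ d ≤ ∫ e^φ d²` w.r.t. `μ₀`; divide by `Z`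
  have hkey : ∫ x, exp (φ x) * d x ∂μ₀ ≤ ∫ x, exp (φ x) * d x ^ 2 ∂μ₀ := by linarith
  rw [integral_tilted, integral_tilted]
  simp only [smul_eq_mul]
  have e1 : ∫ x, exp (φ x) / Z * d x ∂μ₀ = Z⁻¹ * ∫ x, exp (φ x) * d x ∂μ₀ := by
    rw [← integral_const_mul]; refine integral_congr_ae (ae_of_all _ fun x => ?_); ring
  have e2 : ∫ x, exp (φ x) / Z * d x ^ 2 ∂μ₀ = Z⁻¹ * ∫ x, exp (φ x) * d x ^ 2 ∂μ₀ := by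
    rw [← integral_const_mul]; refine integral_congr_ae (ae_of_all _ fun x => ?_); ring
  change ∫ x, exp (φ x) / Z * d x ∂μ₀ ≤ ∫ x, exp (φ x) / Z * (d x) ^ 2 ∂μ₀
  rw [e1, e2]
  exact mul_le_mul_of_nonneg_left hkey (inv_nonneg.2 hZpos.le)


/-- pointwise: `(a - b)² e^{(a+b)/2} ≤ (a - b)(e^a - e^b)` (i.e. `x ≤ 2 sinh (x/2)` for `x ≥ 0`).
[folklore] -/
theorem sq_mul_exp_half_le_sub_mul_exp_sub_exp (a b : ℝ) :
    (a - b) ^ 2 * exp ((a + b) / 2) ≤ (a - b) * (exp a - exp b) := by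
  -- `e^a - e^b = e^{(a+b)/2} (e^{x/2} - e^{-x/2})`, `x = a - b`
  have hfac : exp a - exp b = exp ((a + b) / 2) * (exp ((a - b) / 2) - exp (-((a - b) / 2))) := by
    rw [mul_sub, ← exp_add, ← exp_add]
    congr 1 <;> congr 1 <;> ring
  have hsinh : exp ((a - b) / 2) - exp (-((a - b) / 2)) = 2 * sinh ((a - b) / 2) := by
    rw [Real.sinh_eq]; ring
  rw [hfac, hsinh]
  have hm := exp_pos ((a + b) / 2)
  rcases le_total 0 (a - b) with h | h
  · have h1 : (a - b) / 2 ≤ sinh ((a - b) / 2) := Real.self_le_sinh_iff.2 (by linarith)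
    have h2 : (a - b) ≤ 2 * sinh ((a - b) / 2) := by linarith
    calc (a - b) ^ 2 * exp ((a + b) / 2) = (a - b) * (exp ((a + b) / 2) * (a - b)) := by ring
      _ ≤ (a - b) * (exp ((a + b) / 2) * (2 * sinh ((a - b) / 2))) :=
          mul_le_mul_of_nonneg_left (mul_le_mul_of_nonneg_left h2 hm.le) h
  · have h1 : sinh ((a - b) / 2) ≤ (a - b) / 2 := Real.sinh_le_self_iff.2 (by linarith)
    have h2 : 2 * sinh ((a - b) / 2) ≤ (a - b) := by linarith
    calc (a - b) ^ 2 * exp ((a + b) / 2) = (a - b) * (exp ((a + b) / 2) * (a - b)) := by ring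
      _ ≤ (a - b) * (exp ((a + b) / 2) * (2 * sinh ((a - b) / 2))) :=
          mul_le_mul_of_nonpos_left (mul_le_mul_of_nonneg_left h2 hm.le) h

/-- AM–GM for exponentials: `e^{(a+b)/2} ≤ (e^a + e^b)/2`. [folklore] -/
theorem exp_half_add_le (a b : ℝ) : exp ((a + b) / 2) ≤ (exp a + exp b) / 2 := by
  have h := sq_nonneg (exp (a / 2) - exp (b / 2))
  have ha : exp a = exp (a / 2) * exp (a / 2) := by rw [← exp_add]; congr 1; ring
  have hb : exp b = exp (b / 2) * exp (b / 2) := by rw [← exp_add]; congr 1; ring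
  have hab : exp ((a + b) / 2) = exp (a / 2) * exp (b / 2) := by rw [← exp_add]; congr 1; ring
  nlinarith [h, ha, hb, hab]

/-- **Lower half of the tilted sandwich**: for `μ = μ₀.tilted φ`, `μ₀` a flip-invariant
probability measure, `d := φ - φ∘Θ ∈ L²(μ)`:  `½ ∫ d² e^{-d/2} dμ ≤ KL(μ ‖ Θ_*μ)`.
[folklore] -/
theorem klDiv_flip_tilted_ge_integral_sq_exp [IsProbabilityMeasure μ₀]
    (hinv : μ₀.map (fun x : PhaseSpace N => (x.1, -x.2)) = μ₀)
    {φ : PhaseSpace N → ℝ} (hφm : Measurable φ) (hexp : Integrable (fun x => exp (φ x)) μ₀)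
    (h2 : Integrable (fun x => (φ x - φ (x.1, -x.2)) ^ 2) (μ₀.tilted φ)) :
    ENNReal.ofReal ((1 / 2 : ℝ) * ∫ x, (φ x - φ (x.1, -x.2)) ^ 2 *
        exp (-((φ x - φ (x.1, -x.2)) / 2)) ∂(μ₀.tilted φ)) ≤
      klDiv (μ₀.tilted φ) ((μ₀.tilted φ).map (fun x : PhaseSpace N => (x.1, -x.2))) := by
  set d : PhaseSpace N → ℝ := fun x => φ x - φ (x.1, -x.2) with hd
  have hm : Measurable (fun x : PhaseSpace N => (x.1, -x.2)) := (momentumReversal N).measurable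
  have hdm : Measurable d := hφm.sub (hφm.comp hm)
  have hdodd : ∀ x : PhaseSpace N, d (x.1, -x.2) = -d x := fun x => by simp [hd]
  haveI : IsProbabilityMeasure (μ₀.tilted φ) := isProbabilityMeasure_tilted hexp
  -- `d ∈ L¹(μ)`
  have h1 : Integrable d (μ₀.tilted φ) := by
    refine Integrable.mono' ((integrable_const (1 : ℝ)).add h2) hdm.aestronglyMeasurable
      (ae_of_all _ fun x => ?_)
    rw [Real.norm_eq_abs]
    change |d x| ≤ 1 + (d x) ^ 2
    rcases le_total |d x| 1 with h | h
    · linarith [sq_nonneg (d x)]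
    · have : |d x| ≤ |d x| ^ 2 := by nlinarith
      rw [sq_abs] at this; linarith
  have hfin := (klDiv_flip_tilted_ne_top_iff hinv hφm hexp).2 h1
  rw [← ENNReal.ofReal_toReal hfin, toReal_klDiv_flip_tilted hinv hφm hexp]
  refine ENNReal.ofReal_le_ofReal ?_
  -- weighted `μ₀`-integrals
  set Z := ∫ x, exp (φ x) ∂μ₀ with hZ
  have hZpos : 0 < Z := integral_exp_pos hexp
  have hw1 : Integrable (fun x => exp (φ x) * d x) μ₀ := by
    have := (integrable_tilted_iff hexp d).1 h1; simpa [smul_eq_mul] using this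
  have hw2 : Integrable (fun x => exp (φ x) * d x ^ 2) μ₀ := by
    have := (integrable_tilted_iff hexp (fun x => d x ^ 2)).1 h2; simpa [smul_eq_mul] using this
  have hw1' : Integrable (fun x => exp (φ (x.1, -x.2)) * d x) μ₀ := by
    have h := (integrable_comp_flip_iff μ₀ hinv (fun x => -(exp (φ x) * d x))).2 hw1.neg
    refine h.congr (ae_of_all _ fun x => ?_)
    simp only [hdodd x]; ring
  have hw2' : Integrable (fun x => exp (φ (x.1, -x.2)) * d x ^ 2) μ₀ := by
    have h := (integrable_comp_flip_iff μ₀ hinv (fun x => exp (φ x) * d x ^ 2)).2 hw2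
    refine h.congr (ae_of_all _ fun x => ?_)
    simp only [hdodd x]; ring
  have hI1 : ∫ x, exp (φ (x.1, -x.2)) * d x ∂μ₀ = -∫ x, exp (φ x) * d x ∂μ₀ := by
    rw [← integral_neg, ← integral_comp_flip μ₀ hinv (fun x => -(exp (φ x) * d x))]
    refine integral_congr_ae (ae_of_all _ fun x => ?_)
    simp only [hdodd x]; ring
  -- the symmetric weight `e^{(φ+φΘ)/2} = e^{φ} e^{-d/2}`, integrable since `≤ ½(e^φ + e^{φΘ})`
  have hmid : ∀ x, exp ((φ x + φ (x.1, -x.2)) / 2) = exp (φ x) * exp (-(d x / 2)) := fun x => by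
    rw [← exp_add]; congr 1; simp only [hd]; ring
  have hdom : Integrable (fun x => (exp (φ x) * d x ^ 2 + exp (φ (x.1, -x.2)) * d x ^ 2) / 2) μ₀ :=
    (hw2.add hw2').div_const 2
  have hwm : Integrable (fun x => d x ^ 2 * exp ((φ x + φ (x.1, -x.2)) / 2)) μ₀ := by
    refine Integrable.mono' hdom
      ((hdm.pow_const 2).mul ((hφm.add (hφm.comp hm)).div_const 2).exp).aestronglyMeasurable
      (ae_of_all _ fun x => ?_)
    rw [Real.norm_eq_abs, abs_of_nonneg (by positivity)]
    have hag := exp_half_add_le (φ x) (φ (x.1, -x.2))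
    have hd2 : 0 ≤ d x ^ 2 := sq_nonneg _
    nlinarith [mul_le_mul_of_nonneg_left hag hd2]
  -- pointwise `d² e^{mid} ≤ d (e^φ - e^{φΘ})`, integrated: `∫ d² e^{mid} ≤ 2 ∫ e^φ d`
  have hpt : ∀ x, d x ^ 2 * exp ((φ x + φ (x.1, -x.2)) / 2) ≤
      exp (φ x) * d x - exp (φ (x.1, -x.2)) * d x := fun x => by
    have := sq_mul_exp_half_le_sub_mul_exp_sub_exp (φ x) (φ (x.1, -x.2))
    simp only [hd] at this ⊢
    nlinarith [this]
  have hint : ∫ x, d x ^ 2 * exp ((φ x + φ (x.1, -x.2)) / 2) ∂μ₀ ≤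
      ∫ x, (exp (φ x) * d x - exp (φ (x.1, -x.2)) * d x) ∂μ₀ :=
    integral_mono hwm (hw1.sub hw1') hpt
  rw [integral_sub hw1 hw1', hI1] at hint
  -- back to `μ`
  rw [integral_tilted, integral_tilted]
  simp only [smul_eq_mul]
  change (1 / 2 : ℝ) * ∫ x, exp (φ x) / Z * (d x ^ 2 * exp (-(d x / 2))) ∂μ₀ ≤
    ∫ x, exp (φ x) / Z * d x ∂μ₀
  have e1 : ∫ x, exp (φ x) / Z * (d x ^ 2 * exp (-(d x / 2))) ∂μ₀ =
      Z⁻¹ * ∫ x, d x ^ 2 * exp ((φ x + φ (x.1, -x.2)) / 2) ∂μ₀ := by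
    rw [← integral_const_mul]
    refine integral_congr_ae (ae_of_all _ fun x => ?_)
    beta_reduce
    rw [hmid x]; ring
  have e2 : ∫ x, exp (φ x) / Z * d x ∂μ₀ = Z⁻¹ * ∫ x, exp (φ x) * d x ∂μ₀ := by
    rw [← integral_const_mul]
    refine integral_congr_ae (ae_of_all _ fun x => ?_)
    ring
  rw [e1, e2]
  have hZi : 0 ≤ Z⁻¹ := inv_nonneg.2 hZpos.le
  nlinarith [mul_le_mul_of_nonneg_left hint hZi]


/-- **Sufficient condition for (K): an `L²(μ_δ)` bound on the odd part of the NESS log-density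
relative to the Gibbs state at the mean temperature.** -/
def OddLogDensityBound : Prop :=
  ∀ ω₂ lam β γ : ℝ, 0 < ω₂ → 0 < lam → 0 < β → 0 < γ → UniqAt ω₂ lam β γ →
    ∀ μ : Family, IsFamily ω₂ lam β γ μ → ∀ T : ℝ, 0 < T →
      ∃ C : ℝ, ∀ N : ℕ, ∀ᶠ δ in 𝓝[≠] (0 : ℝ), ∃ φ : PhaseSpace N → ℝ, Measurable φ ∧
        Integrable (fun x => Real.exp (φ x)) ((pinnedChain ω₂ lam β γ).gibbsMeasure N T) ∧
        μ N (T + δ / 2) (T - δ / 2) = ((pinnedChain ω₂ lam β γ).gibbsMeasure N T).tilted φ ∧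
        Integrable (fun x => (φ x - φ (x.1, -x.2)) ^ 2) (μ N (T + δ / 2) (T - δ / 2)) ∧
        ∫ x, (φ x - φ (x.1, -x.2)) ^ 2 ∂(μ N (T + δ / 2) (T - δ / 2)) ≤ C * N * δ ^ 2

/-- **(K) from the odd-log-density bound** (sorry-free; uses only flip-invariance of the Gibbs
state and `klDiv_flip_tilted_le_integral_sq`). -/
theorem crux_of_oddLogDensityBound (h : OddLogDensityBound) : ExtensiveSnapshotIrreversibility := by
  rw [crux_iff]
  intro ω₂ lam β γ hω hl hβ hγ hU μ hμ T hT
  obtain ⟨C, hC⟩ := h ω₂ lam β γ hω hl hβ hγ hU μ hμ T hT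
  refine ⟨C, fun N => ?_⟩
  filter_upwards [hC N] with δ hδ
  obtain ⟨φ, hφm, hexp, hμeq, h2, hbound⟩ := hδ
  haveI := pinnedChain_isProbabilityMeasure_gibbsMeasure hω hl.le hβ.le γ N hT
  have hinv := gibbsMeasure_map_flip (pinnedChain ω₂ lam β γ) N T
  unfold snapKL
  rw [hμeq] at h2 hbound ⊢
  exact (klDiv_flip_tilted_le_integral_sq hinv hφm hexp h2).trans (ENNReal.ofReal_le_ofReal hbound)


/-! ## 10. Targets (cycle 3): the seven stubs of the PICKED line `clausius-budget-sound-window`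

Skeleton: `Cruxes/ExtensiveSnapshotIrreversibility/Lines/clausius-budget-sound-window.lean` (lead v2, skeleton sha
`d0d51885…`, 7 registered stubs; composition `ExtensiveSnapshotIrreversibility_of` sorry-free).  Payload `targets` /
`stuck_stubs` were empty at this re-arm (lead at cycle 0), so the stubs were attacked as filed.  Verdicts of this
seat (they agree with the drefute seat's `DrefuteClausiusBudgetSoundWindow.md`, whose re-derivations I checked):

* S0 `stub_equilibriumKernelFacts` — LANDED (p77081, lead).  Nothing to attack; it is also the non-vacuity
  certificate for the (INV)/(MIX) hypothesis blocks carried by S1/S2a/S3b/S4.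
* S1 `stub_klExpansion` — SURVIVES.  Fixed `N`; the constant `½∫(w − w∘Θ)²dμ_T` is right (§7 and four seats);
  the `∀ ε > 0` form is necessary-shaped; it silently contains `SnapshotKLFinite` (§7) — a kill would be a PROOF
  of `KL(μ_δ‖Θμ_δ) = ∞`, for which there is no handle (§8, §9: finiteness `⟺ φ_δ − φ_δ∘Θ ∈ L¹(μ_δ)`).  Extra
  debt not supplied by S0 or the guard: Θ-detailed balance `P_s† = ΘP_sΘ` on `L²(μ_T)` for the CONSTRUCTED
  kernels (McLennan identification `h = w∘Θ`).
* S2a `stub_correctorIntegrability` — SURVIVES (true plumbing): joint measurability of `(t, z) ↦ κ_t(z)` IS in tree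
  (`pinnedChain_measurable_transitionKernel`), so `s ↦ Pg s z` is measurable and the "for every `z`" window
  identity is honest (CK `pinnedChain_transitionKernel_add` + Fubini with the `e^{ϑH}` majorant of (3.4)).
  `μ_T(g) = 0` needs `∫p_0² dμ_T = ∫p_{N−1}² dμ_T` (Gaussian momentum marginal of the Gibbs state) — not yet a
  tree lemma, true.
* S2b `stub_correctorCocycle`, S3a `stub_gibbsContactCalculus` — candidate proofs attached by the drefute seat
  (S2bCandidate.lean, S3aCandidate.lean, rc 0); theorems.
* S3b `stub_clausiusBudget` — SURVIVES; formally a theorem.  `normSq_le_of_dissipation` below is its EXACT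
  functional-analytic shape: the budget `‖k_t‖² ≤ γt/(4T²)` follows from (i) differentiability of
  `t ↦ k_t ∈ L²(μ_T)` with derivative `L̄k_t + g` and (ii) the dissipation/pumping bound
  `⟪k_t, L̄k_t + g⟫ ≤ −γT(x₀² + x₁²) + (γ/(2√T))(x₀ + x₁)`, `x_i = ‖∂_{p_i}k_t‖`, ALONG THE ORBIT — nothing
  else (`clausius_rate_le` certifies the constant).  So the lead's only debt in S3b is to put the orbit in the
  form domain (core / mollification), exactly as its docstring says.  Tight to 19 % (OU transient
  `(1 − e^{−2x})²/x ≤ 0.8145`), so "γt/(5T²)" is false at the corner — not claimed.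
* S4 `stub_lateOddResponse` — SURVIVES; `⟹ (K)` is the glue.  PRECISION ON THE CONVERSE: `(K) ⟹ S4` needs the
  LOWER half of the KL expansion (`liminf δ⁻²KL ≥ ½D(w)`), which NO stub of the line states (S1 is the upper
  half only): `lateShape_of_lower_expansion` + `le_of_eventually_sq_sandwich` below.  The tool for the lower
  half is the tilted floor `klDiv_flip_tilted_ge_integral_sq_exp` (§9, landed `Negative/TiltedFloor` p77259).
  So "S4 ⟺ (K) given S0–S3" holds only with the two-sided S1; as filed, S4 could in principle be STRONGER
  than (K) by exactly the gap between limsup and liminf of `δ⁻²KL` — immaterial if the expansion exists.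

Formal shield made explicit (`uniqAt_of_not_crux`): any proof of `¬(K)` exhibits a parameter point where the
guard holds for all `N, T_L, T_R` — i.e. proves an instance of `NessUnique` (0741), which the tree cannot do yet.
-/

/-- **Formal shield.** A refutation of the crux produces positive parameters at which weak-NESS uniqueness
holds for every `N, T_L, T_R > 0` (an instance of route item `NessUnique`). -/
theorem uniqAt_of_not_crux (h : ¬ ExtensiveSnapshotIrreversibility) :
    ∃ ω₂ lam β γ : ℝ, 0 < ω₂ ∧ 0 < lam ∧ 0 < β ∧ 0 < γ ∧ UniqAt ω₂ lam β γ ∧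
      ∃ μ : Family, IsFamily ω₂ lam β γ μ ∧ ∃ T : ℝ, 0 < T ∧ ¬ Concl μ T := by
  by_contra hcon
  apply h
  rw [crux_iff]
  intro ω₂ lam β γ hω hl hβ hγ hU μ hμ T hT
  by_contra hC
  exact hcon ⟨ω₂, lam, β, γ, hω, hl, hβ, hγ, hU, μ, hμ, T, hT, hC⟩

/-- **The Clausius rate** (scalar core of S3b): `-a x² + b x ≤ b²/(4a)` for `a > 0`. [folklore] -/
theorem neg_mul_sq_add_mul_le {a b : ℝ} (ha : 0 < a) (x : ℝ) : -a * x ^ 2 + b * x ≤ b ^ 2 / (4 * a) := by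
  rw [le_div_iff₀ (by positivity)]
  nlinarith [sq_nonneg (2 * a * x - b)]

/-- **S3b's constant certified**: with `a = γT`, `b = γ/(2√T)` per contact, the two contacts pump at most
`γ/(8T²)` into `½‖k_t‖²`, i.e. `d/dt ‖k_t‖² ≤ γ/(4T²)`. [folklore] -/
theorem clausius_rate_le {γ T : ℝ} (hγ : 0 < γ) (hT : 0 < T) (x₀ x₁ : ℝ) :
    (-(γ * T) * x₀ ^ 2 + γ / (2 * Real.sqrt T) * x₀) +
      (-(γ * T) * x₁ ^ 2 + γ / (2 * Real.sqrt T) * x₁) ≤ γ / (8 * T ^ 2) := by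
  have ha : 0 < γ * T := mul_pos hγ hT
  have h0 := neg_mul_sq_add_mul_le (b := γ / (2 * Real.sqrt T)) ha x₀
  have h1 := neg_mul_sq_add_mul_le (b := γ / (2 * Real.sqrt T)) ha x₁
  have hs : Real.sqrt T ^ 2 = T := Real.sq_sqrt hT.le
  have hsp : 0 < Real.sqrt T := Real.sqrt_pos.2 hT
  have key : (γ / (2 * Real.sqrt T)) ^ 2 / (4 * (γ * T)) = γ / (16 * T ^ 2) := by
    rw [div_pow, mul_pow, hs]
    field_simp
    ring
  rw [key] at h0 h1
  have : γ / (16 * T ^ 2) + γ / (16 * T ^ 2) = γ / (8 * T ^ 2) := by ring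
  linarith

/-- Scalar comparison: `φ(0) = 0` and `φ' ≤ r` on `[0, ∞)` give `φ(t) ≤ r t`. [folklore] -/
theorem le_mul_of_hasDerivAt_le {φ φ' : ℝ → ℝ} {r : ℝ} (hφ0 : φ 0 = 0)
    (hderiv : ∀ t, 0 ≤ t → HasDerivAt φ (φ' t) t) (hle : ∀ t, 0 ≤ t → φ' t ≤ r) {t : ℝ}
    (ht : 0 ≤ t) : φ t ≤ r * t := by
  rcases ht.eq_or_lt with rfl | htpos
  · simp [hφ0]
  have hcont : ContinuousOn φ (Set.Icc 0 t) := fun x hx =>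
    (hderiv x hx.1).continuousAt.continuousWithinAt
  obtain ⟨ξ, hξ, hslope⟩ := exists_hasDerivAt_eq_slope φ φ' htpos hcont
    (fun x hx => hderiv x hx.1.le)
  have hξ' : φ' ξ ≤ r := hle ξ hξ.1.le
  rw [hφ0, sub_zero, sub_zero] at hslope
  have : φ t = φ' ξ * t := by
    rw [hslope]; field_simp
  rw [this]
  exact mul_le_mul_of_nonneg_right hξ' ht

open scoped RealInnerProductSpace in
/-- **Abstract Clausius budget = the exact shape of S3b.**  In a real inner product space, an orbit
`k : ℝ → E` with `k 0 = 0`, derivative `v t` at every `t ≥ 0`, and the dissipation/pumping bound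
`⟪k t, v t⟫ ≤ −a(x₀² + x₁²) + b(x₀ + x₁)` for some reals `x₀(t), x₁(t)` (`a > 0`) obeys
`‖k t‖² ≤ (b²/a) t`.  With `a = γT`, `b = γ/(2√T)`: `‖k t‖² ≤ γt/(4T²)`.  Hence S3b reduces EXACTLY to:
(i) `t ↦ k_t` differentiable in `L²(μ_T)` with derivative `L̄k_t + g`; (ii) the two form bounds along the orbit
(contact Dirichlet form of S3a(a) on the orbit, Gaussian IBP S3a(b) on the orbit). [folklore] -/
theorem normSq_le_of_dissipation {E : Type*} [NormedAddCommGroup E] [InnerProductSpace ℝ E]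
    {k v : ℝ → E} {a b : ℝ} (ha : 0 < a) (hk0 : k 0 = 0)
    (hderiv : ∀ t, 0 ≤ t → HasDerivAt k (v t) t)
    (hdiss : ∀ t, 0 ≤ t → ∃ x₀ x₁ : ℝ,
      ⟪k t, v t⟫ ≤ -a * (x₀ ^ 2 + x₁ ^ 2) + b * (x₀ + x₁))
    {t : ℝ} (ht : 0 ≤ t) : ‖k t‖ ^ 2 ≤ b ^ 2 / a * t := by
  have hφ : ∀ s, 0 ≤ s → HasDerivAt (fun u => ⟪k u, k u⟫) (⟪k s, v s⟫ + ⟪v s, k s⟫) s :=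
    fun s hs => (hderiv s hs).inner ℝ (hderiv s hs)
  have hle : ∀ s, 0 ≤ s → ⟪k s, v s⟫ + ⟪v s, k s⟫ ≤ b ^ 2 / a := by
    intro s hs
    obtain ⟨x₀, x₁, h⟩ := hdiss s hs
    have h0 := neg_mul_sq_add_mul_le (b := b) ha x₀
    have h1 := neg_mul_sq_add_mul_le (b := b) ha x₁
    have hc : ⟪v s, k s⟫ = ⟪k s, v s⟫ := real_inner_comm _ _
    have : b ^ 2 / (4 * a) + b ^ 2 / (4 * a) = b ^ 2 / a / 2 := by field_simp; ring
    nlinarith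
  have h := le_mul_of_hasDerivAt_le (φ := fun u => ⟪k u, k u⟫) (by simp [hk0]) hφ hle ht
  simpa [real_inner_self_eq_norm_sq] using h

/-- Two eventual bounds `a δ² ≤ f δ ≤ b δ²` on the punctured neighbourhood of `0` compare the constants
(the punctured filter is non-trivial and `δ² > 0` on it). [folklore] -/
theorem le_of_eventually_sq_sandwich {a b : ℝ} {f : ℝ → ℝ≥0∞} (hb : 0 ≤ b)
    (h₁ : ∀ᶠ δ in 𝓝[≠] (0 : ℝ), ENNReal.ofReal (a * δ ^ 2) ≤ f δ)
    (h₂ : ∀ᶠ δ in 𝓝[≠] (0 : ℝ), f δ ≤ ENNReal.ofReal (b * δ ^ 2)) : a ≤ b := by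
  obtain ⟨δ, ⟨h1, h2⟩, hδ⟩ := ((h₁.and h₂).and self_mem_nhdsWithin).exists
  have hδ0 : δ ≠ 0 := hδ
  have hδ2 : 0 < δ ^ 2 := by positivity
  have h := (ENNReal.ofReal_le_ofReal_iff (by positivity)).1 (h1.trans h2)
  exact le_of_mul_le_mul_right h hδ2

/-- **`(K) ⟹ S4` needs the LOWER half of the KL expansion** (real-arithmetic certificate).  If eventually
`(Dw/2 − ε)δ² ≤ KL ≤ C N δ²` (lower expansion + crux bound, compared by `le_of_eventually_sq_sandwich`), the
reverse window split `√Dl ≤ √Dw + 2√Wk` (`P_τ w = w − k_τ`, Minkowski, flip-invariance of `μ_T`) and the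
Clausius budget `Wk ≤ γτ/(4T²)` at some `τ ≤ cN`, then `Dl ≤ (4C + 2γc/T² + 4ε)·N` — S4's conclusion.  The
UPPER expansion S1 alone gives nothing in this direction. [folklore] -/
theorem lateShape_of_lower_expansion {Dw Wk Dl C ε γ T c τ N : ℝ} (hN : 1 ≤ N) (hε : 0 ≤ ε)
    (hγ : 0 ≤ γ) (hT : 0 < T) (hDw : 0 ≤ Dw) (hWk : 0 ≤ Wk) (hDl : 0 ≤ Dl)
    (hlow : Dw / 2 - ε ≤ C * N)
    (hsplit : Real.sqrt Dl ≤ Real.sqrt Dw + 2 * Real.sqrt Wk)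
    (hbudget : Wk ≤ γ * τ / (4 * T ^ 2)) (hτ : τ ≤ c * N) :
    Dl ≤ (4 * C + 2 * γ * c / T ^ 2 + 4 * ε) * N := by
  have hT2 : 0 < T ^ 2 := by positivity
  have h1 : Dl ≤ 2 * Dw + 8 * Wk := by
    have hsq : Real.sqrt Dl * Real.sqrt Dl ≤
        (Real.sqrt Dw + 2 * Real.sqrt Wk) * (Real.sqrt Dw + 2 * Real.sqrt Wk) :=
      mul_self_le_mul_self (Real.sqrt_nonneg _) hsplit
    rw [Real.mul_self_sqrt hDl] at hsq
    nlinarith [Real.mul_self_sqrt hDw, Real.mul_self_sqrt hWk, Real.sqrt_nonneg Dw,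
      Real.sqrt_nonneg Wk, sq_nonneg (Real.sqrt Dw - 2 * Real.sqrt Wk)]
  have h2 : Wk ≤ γ * (c * N) / (4 * T ^ 2) :=
    hbudget.trans (div_le_div_of_nonneg_right (mul_le_mul_of_nonneg_left hτ hγ) (by positivity))
  have h3 : Dw ≤ 2 * C * N + 2 * ε := by linarith
  have h4 : 8 * (γ * (c * N) / (4 * T ^ 2)) = 2 * γ * c / T ^ 2 * N := by
    field_simp; ring
  have hεN : ε ≤ ε * N := le_mul_of_one_le_right hε hN
  nlinarith [h1, h2, h3, h4, hεN]


/-! ### Numerical addendum (cycle 3): branching-MD in the line's own currency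

Kit job j012250 (this seat; `kn_job/main.py`, BAOAB `h = 0.02`, equilibrium dynamics `T_L = T_R = T = 1`,
`ω₂ = γ = 1`, harmonic member `lam = β = 0`, `M = 4·10⁴` samples): the McLennan corrector `w = ∫₀^∞ P_s g ds` of the
boundary entropy source `g = (γ/2T²)(p_0² − p_{N−1}²)` sampled by four conditionally independent branches from
`X₀ ~ μ_T` and `ΘX₀` (identities `A_N = ‖w‖² = E[I I′]`, `B_N = ⟨w, w∘Θ⟩ = E[I Ĩ] = ∫₀^∞ t⟨g,P_t g⟩dt`,
`K_N = ½D(w) = ½E[(I − Ĩ)(I′ − Ĩ′)]`, `I = ∫₀^τ g(X_t)dt`):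

| N | `K_N = ½D(w)` (MD) | exact Gaussian `tr(M_o²)` | `G_N` from `∫C_gg = (γ/2T²)(1 − 2G_N/γ)` | exact | `sup_τ ‖k_τ‖²/(γτ/4T²)` |
|---|---|---|---|---|---|
| 2 | 0.228 ± 0.058 | 2/9 = 0.2222 | 0.1675 | 1/6 | 0.755 |
| 4 | 0.456 ± 0.181 | 0.4694 | 0.1255 | 0.1279 | 0.767 |

Reading: (i) the S1 constant `½D(w)` in the CORRECTOR currency (source `g`, McLennan identification `h = w∘Θ`)
reproduces the snapshot-irreversibility coefficient computed by four seats from the NESS covariances — an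
independent check of the normalisation that S1 claims with every `ε > 0`; (ii) the Clausius budget S3b holds at
its tightest window with 23–25 % slack (triage predicted 0.770–0.814 from the OU transient); (iii) `K(τ)` is
converged by `τ ≈ 2.5N` at the corner (`K_2(8) = 0.231`, `K_4(15) = 0.51 → 0.46`), which sizes the anharmonic
scan: job j014002 (`lam = β ∈ {0, 0.3, 1, 3}`, `N ∈ {2,4,6,8}`, `τ_max = 5N`, `M = 2–3·10⁵`; by the exact scaling
`K_N(T; lam, β) = K_N(1; lamT, βT)/T²` this is also a temperature scan).  Its table is appended here / in NOTES when
it returns (results auto-attach to the item).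
-/


end

end Summit.AtomisticToContinuum.FouriersLaw.Cruxes.ExtensiveSnapshotIrreversibility.Disproof
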